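import Literature.NumberTheory.LFunctions.ChebyshevHalfLineBiasCharExplicitFormula
import HarnessLib

/-!
# GRH-CONDITIONAL asymptotics inside a GRH-EQUIVALENT criterion (Suzuki 2025, §4.1 (4.4')–(4.5'); Thm 8 (4.2') «if»), PROVED — «nothing here bears on the truth of RH»
# A zero of `L(s, χ)` at `s = ½` of order `m`: the exact formulas with the term `−(m/2) log²x`, RH-FREE, and `f_χ(x)/log²x → −m/2` under GRH

LINE 1 — LABEL: RH-FREE literature (exact explicit formulas for the half-line Riesz means of `Λχ`, valid when
`L(½, χ) = 0`, proved unconditionally) with GRH-CONDITIONAL corollaries (boundedness of the zero term under the GRH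
for `L(s, χ)`, hence the Riesz limit (4.2') of Thm 8, clause (c), direction «GRH ⟹ (4.2')», for PRIMITIVE `χ`).
bears_on: LADDER-RH COLUMN 1 SCREW (S-C, criterion rung). WHAT THIS IS NOT: not a route, not progress toward RH
or GRH; an implication «GRH ⟹ limit statement»; nothing here bears on the truth of RH.

M. Suzuki, *On variants of Chebyshev's conjecture*, Ramanujan J. **68** (2025), no. 4, art. 95 = arXiv:2411.07436
[`Suzuki2025Chebyshev`; PUBLISHED, refereed], §4.1, proof of **Theorem 8** (the order-`m` half), AS PRINTED: «if
`L(s, χ)` has a zero at `s = 1/2` with multiplicity `m`»,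
`∫_1^∞ f_χ(x) x^{−s−1/2} dx = −(s − ½)^{−2}(L'/L)(s, χ)` (4.4') «holds for `Re(s) > 1/2` … and
`f_χ(x) = −(m/2)(log x)² − lim_{s→1/2}[(L'/L)(s, χ) − m/(s − 1/2)]·log x − lim_{s→1/2}[(L'/L)'(s) + m/(s − 1/2)²]
 − Σ_{ρ≠1/2} x^{ρ−1/2}/(ρ−1/2)² − Σ_k x^{−2k−κ*−1/2}/(2k+κ*+1/2)²` (4.5') … Assuming the GRH for `L(s)` … each term
of the right-hand side (4.5') is bounded except for the first and second terms. Hence (4.2') holds.»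

## What is proved here (continuing the tree's `ChebyshevHalfLineBiasCharExplicitFormula.lean`, whose §§1–7 treat `L(½, χ) ≠ 0`)

For a primitive `χ` mod `q > 1` with `L(½, χ) = 0` (order `m = DirichletDisc.zeroOrder χ (1/2) ≥ 1`):

* `exists_tendsto_logDeriv_sub_polar` — the constant term `c₀ = lim_{s→½}[(L'/L)(s, χ) − m/(s − ½)]` exists
  (`L = (s − ½)^m g` near `½`, Mathlib's `analyticOrderAt`; `c₀ = (g'/g)(½)`);
* `charFordK_half_eq_explicit_of_zero` — **the exact smoothed explicit formula at `s = ½` for every admissible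
  smoothing `f`** (Heath-Brown's Lemma 5.1 in the tree's form `charFordK_eq_explicit`, which requires `L(s, χ) ≠ 0`):
  `K_{f,χ}(½) = −f(0)c₀ − Σ'_ρ m(ρ)F₀(½ − ρ) − Σ_τ m(τ)F₀(½ − τ) + J_χ(f, ½)`, where the term of `ρ = ½` is
  `m·F₀(0) = m·F(0)` (`F` the Laplace transform of `f`; in Lean `f(0)/0 = 0`). Proof: the tree's formula at
  `s = ½ + δ`, `0 < δ` small (no zero there: the other zeros stay at distance `≥ d`, `exists_dist_charZeros_ge'`);
  `−f(0)(L'/L)(½+δ) − mF₀(δ) = −f(0)[(L'/L)(½+δ) − m/δ] − mF(δ)`; every other term is continuous in `s` at `½`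
  (the punctured zero sum by the uniform majorant `4D·m(ρ)/‖½−ρ‖²`, `continuousOn_zeroSum_punctured`,
  `summable_zeroOrder_div_norm_sq'`; the left-line integral `J` by dominated convergence,
  `continuousAt_charEFRemainder_half`; `K_{f,χ}` is a finite sum); limits along `δ → 0⁺` are unique;
* `rieszTwo_eq_explicit_of_zero` — with the quadratic weight `h_L` (`F(0) = L³/6`):
  `F₂(L) = −(L²/2)c₀ − mL³/6 − Z(L) − T(L) + J(L)`;
* `halfLineSum_eq_explicit_of_zero` — **(4.5') as an RH-FREE exact formula**: for `x > 1`,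
  `f_χ(x) = −c₀ log x − (m/2) log²x + Σ_ρ m(ρ)(1 − x^{ρ−½})/(½−ρ)² + Σ_τ m(τ)(1 − x^{τ−½})/(½−τ)² + J'(log x)`
  (the `L`-derivative, termwise under the zero sum — `hasDerivAt_zeroSide'`, now without `L(½, χ) ≠ 0` — and under
  `J`, by uniqueness of derivatives against `F₂' = f_χ(e^L)`);
* `exists_norm_halfLineSum_add_le_of_GRH_of_zero` — **GRH ⟹ `‖f_χ(x) + c₀ log x + (m/2) log²x‖ ≤ B`** (`x > 1`);
* `tendsto_rieszMean_div_log_of_GRH` — **GRH ⟹ (4.2')** for every PRIMITIVE `χ` mod `q > 1` (whether or not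
  `L(½, χ) = 0`): `(1/log x) Σ_{n ≤ x} Λ(n)χ(n) n^{-1/2}(1 − log n/log x) → −m/2`, the sum and the limit
  `−((DirichletDisc.zeroOrder χ (1/2) : ℂ)/2)` exactly as typed in clause (c) of `Suzuki2025Chebyshev_thm8_limits`.

Not proved here: the imprimitive cases of «GRH ⟹ (4.2)» and «GRH ⟹ (4.2')» (reduction to the inducing primitive
character; in flight on the rh-columns board), hence `Suzuki2025Chebyshev_thm8_limits` is NOT discharged by this
file (its clause (b) is the tree's `DirichletLogDerivHalf.Suzuki2025Chebyshev_thm8_clause_b`, its «⟹ GRH» halves are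
`DirichletHalfLineRiesz.riemannHypothesis_of_tendsto_rieszMean{,_div_log}`). §0 restates privately the plumbing
lemmas that are private in `ChebyshevHalfLineBiasCharExplicitFormula.lean`. Theorems only (D-0014/D-0026): no
definitions, no named facts.

## References
* [Suzuki2025Chebyshev] M. Suzuki, Ramanujan J. 68 (2025) 95 = arXiv:2411.07436: §4.1 Thm 8, (4.2'), (4.4'), (4.5').
* [HeathBrown1992PLMS] D. R. Heath-Brown, Proc. London Math. Soc. (3) 64 (1992) 265–338, Lemma 5.1 — the tree's
  `SmoothedExplicitFormulaChar.lean` (`charFordK_eq_explicit`).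
* [Ford2002Millennium] K. Ford, *Zero-free regions for the Riemann zeta function* (2002), Lemma 4.5 (`F₀ = F − f(0)/z`).
* [MontgomeryVaughan2007] H. L. Montgomery, R. C. Vaughan, *Multiplicative Number Theory I*, Lemma 12.9 (`L'/L` on
  the left line), Cor. 10.8 (trivial zeros).
-/

noncomputable section

open Complex Real MeasureTheory Set Filter Topology ArithmeticFunction

namespace Literature.NumberTheory.LFunctions

namespace HalfLineRiesz

open ExplicitPsiChar

/-! ## §0 Plumbing (the private lemmas of `ChebyshevHalfLineBiasCharExplicitFormula.lean`, restated privately) -/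

variable {q : ℕ}

/-- `h_L(u) = (L − u)²/2` for `u ≤ L`. [folklore] -/
private theorem quadWeight_eq_of_le {L u : ℝ} (h : u ≤ L) : quadWeight L u = (L - u) ^ 2 / 2 := by
  rw [quadWeight, max_eq_left (sub_nonneg.2 h)]

/-- `h_L(u) = 0` for `u ≥ L`. [folklore] -/
private theorem quadWeight_eq_zero_of_le {L u : ℝ} (h : L ≤ u) : quadWeight L u = 0 := by
  rw [quadWeight, max_eq_right (sub_nonpos.2 h)]
  simp

/-- `h_L(0) = L²/2` (`L ≥ 0`). [folklore] -/
private theorem quadWeight_zero {L : ℝ} (hL : 0 ≤ L) : quadWeight L 0 = L ^ 2 / 2 := by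
  rw [quadWeight_eq_of_le hL, sub_zero]

/-- `L ↦ e^{−zL}` has derivative `−z e^{−zL}`. [folklore] -/
private theorem hasDerivAt_cexp_neg_mul_ofReal (z : ℂ) (L : ℝ) :
    HasDerivAt (fun L : ℝ ↦ cexp (-(z * L))) (-z * cexp (-(z * L))) L := by
  have h1 : HasDerivAt (fun L : ℝ ↦ (L : ℂ)) 1 L := (hasDerivAt_id L).ofReal_comp
  have h2 : HasDerivAt (fun L : ℝ ↦ -(z * (L : ℂ))) (-(z * 1)) L := (h1.const_mul z).neg
  refine h2.cexp.congr_deriv ?_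
  ring

/-- **`∂_L H₀`**: `L ↦ H₀(z; L)` has derivative `−(1 − e^{−zL})/z²` (`z ≠ 0`). [folklore] -/
private theorem hasDerivAt_quadLaplace₀ {z : ℂ} (hz : z ≠ 0) (L : ℝ) :
    HasDerivAt (fun L : ℝ ↦ quadLaplace₀ z L) (quadLaplace₀Deriv z L) L := by
  have h1 : HasDerivAt (fun L : ℝ ↦ (L : ℂ)) 1 L := (hasDerivAt_id L).ofReal_comp
  have he := hasDerivAt_cexp_neg_mul_ofReal z L
  have h2 : HasDerivAt (fun L : ℝ ↦ (-(L : ℂ) + (1 - cexp (-(z * L))) / z) / z ^ 2)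
      ((-1 + (0 - (-z * cexp (-(z * L)))) / z) / z ^ 2) L :=
    (h1.neg.add (((hasDerivAt_const L (1 : ℂ)).sub he).div_const z)).div_const (z ^ 2)
  refine h2.congr_deriv ?_
  rw [quadLaplace₀Deriv]
  field_simp
  ring

/-- `‖∂_L H₀(z; L)‖ ≤ (1 + e^{−Re z · L})/‖z‖²`. [folklore] -/
private theorem norm_quadLaplace₀Deriv_le (z : ℂ) (L : ℝ) :
    ‖quadLaplace₀Deriv z L‖ ≤ (1 + rexp (-(z.re * L))) / ‖z‖ ^ 2 := by
  rw [quadLaplace₀Deriv, norm_div, norm_neg, norm_pow]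
  by_cases hz : z = 0
  · simp [hz]
  gcongr
  refine (norm_sub_le _ _).trans ?_
  rw [norm_one, Complex.norm_exp]
  simp

/-- `φ(x) = (x⁺)²/2` has derivative `x⁺` everywhere. [folklore] -/
private theorem hasDerivAt_posPart_sq_half (x : ℝ) :
    HasDerivAt (fun x : ℝ ↦ max x 0 ^ 2 / 2) (max x 0) x := by
  rcases lt_trichotomy x 0 with hx | rfl | hx
  · -- locally `0`
    have hev : (fun x : ℝ ↦ max x 0 ^ 2 / 2) =ᶠ[𝓝 x] fun _ ↦ 0 := by
      filter_upwards [Iio_mem_nhds hx] with y hy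
      rw [max_eq_right (le_of_lt hy)]; simp
    rw [max_eq_right hx.le]
    exact (hasDerivAt_const x (0 : ℝ)).congr_of_eventuallyEq hev
  · -- at `0`: `|φ(h)| ≤ h²/2 = o(h)`
    rw [max_self]
    rw [hasDerivAt_iff_isLittleO_nhds_zero]
    simp only [zero_add, smul_zero, sub_zero, max_self, ne_eq, OfNat.ofNat_ne_zero,
      not_false_eq_true, zero_pow, zero_div]
    refine Asymptotics.IsLittleO.of_bound fun c hc ↦ ?_
    filter_upwards [Metric.ball_mem_nhds (0 : ℝ) (by positivity : (0 : ℝ) < 2 * c)] with h hh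
    rw [Metric.mem_ball, dist_zero_right, Real.norm_eq_abs] at hh
    rw [Real.norm_eq_abs, Real.norm_eq_abs, abs_div, abs_pow, abs_two]
    have hm : |max h 0| ≤ |h| := by
      rw [abs_of_nonneg (le_max_right _ _)]
      exact max_le (le_abs_self h) (abs_nonneg h)
    have h0 : 0 ≤ |h| := abs_nonneg h
    calc |max h 0| ^ 2 / 2 ≤ |h| ^ 2 / 2 := by gcongr
      _ = (|h| / 2) * |h| := by ring
      _ ≤ c * |h| := by
          refine mul_le_mul_of_nonneg_right ?_ h0
          linarith
  · -- locally `x²/2`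
    have hev : (fun x : ℝ ↦ max x 0 ^ 2 / 2) =ᶠ[𝓝 x] fun y ↦ y ^ 2 / 2 := by
      filter_upwards [Ioi_mem_nhds hx] with y hy
      rw [max_eq_left (le_of_lt hy)]
    rw [max_eq_left hx.le]
    have h := ((hasDerivAt_id x).pow 2).div_const 2
    refine (h.congr_of_eventuallyEq hev).congr_deriv ?_
    simp

/-- `L ↦ h_L(a)` has derivative `(L − a)⁺`. [folklore] -/
private theorem hasDerivAt_quadWeight_left (a L : ℝ) :
    HasDerivAt (fun L : ℝ ↦ quadWeight L a) (max (L - a) 0) L := by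
  have h := (hasDerivAt_posPart_sq_half (L - a)).comp L ((hasDerivAt_id L).sub_const a)
  simpa [quadWeight, Function.comp_def] using h

/-- For `L < log N` (`N ≥ 1`), `F₂(L)` is the finite sum over `n < N`. [folklore] -/
private theorem rieszTwo_eq_sum (χ : DirichletCharacter ℂ q) {N : ℕ} (hN : 1 ≤ N) {L : ℝ} (hL : L ≤ Real.log N) :
    rieszTwo χ L = ∑ n ∈ Finset.range N,
      ((Λ n : ℝ) : ℂ) * χ n * (quadWeight L (Real.log n) : ℂ) * (n : ℂ) ^ (-(1 / 2 : ℂ)) :=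
  ExplicitPsiChar.charFordK_eq_sum χ (fun _ hu ↦ quadWeight_eq_zero_of_le hu) hN hL _

/-- `n^{-1/2} = 1/√n` in `ℂ` for `n ≥ 1`. [folklore] -/
private theorem natCast_cpow_neg_half {n : ℕ} (hn : 1 ≤ n) :
    (n : ℂ) ^ (-(1 / 2 : ℂ)) = 1 / (Real.sqrt n : ℂ) := by
  have hn0 : (0 : ℝ) < n := by exact_mod_cast hn
  rw [show (n : ℂ) = ((n : ℝ) : ℂ) by norm_cast,
    show (-(1 / 2 : ℂ)) = ((-(1 / 2) : ℝ) : ℂ) by push_cast; ring,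
    ← Complex.ofReal_cpow hn0.le, Real.rpow_neg hn0.le, Real.sqrt_eq_rpow]
  push_cast
  ring

/-- **`F₂'(L) = f_χ(e^L)`**: the second Riesz mean is differentiable in `L` with derivative the first
Riesz mean. [folklore] -/
private theorem hasDerivAt_rieszTwo (χ : DirichletCharacter ℂ q) (L : ℝ) :
    HasDerivAt (rieszTwo χ) (halfLineSum χ (rexp L)) L := by
  -- a level `N` with `L + 1 ≤ log N`
  obtain ⟨N, hN⟩ : ∃ N : ℕ, rexp (L + 1) ≤ N := exists_nat_ge _
  have hN1 : 1 ≤ N := by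
    have : (0 : ℝ) < N := (Real.exp_pos _).trans_le hN
    exact_mod_cast this
  have hlogN : L + 1 ≤ Real.log N := by
    have := Real.log_le_log (Real.exp_pos _) hN
    rwa [Real.log_exp] at this
  -- locally `F₂` is the finite sum
  have hev : rieszTwo χ =ᶠ[𝓝 L] fun L' ↦ ∑ n ∈ Finset.range N,
      ((Λ n : ℝ) : ℂ) * χ n * (quadWeight L' (Real.log n) : ℂ) * (n : ℂ) ^ (-(1 / 2 : ℂ)) := by
    filter_upwards [Iio_mem_nhds (show L < L + 1 by linarith)] with L' hL'
    exact rieszTwo_eq_sum χ hN1 (by linarith [Set.mem_Iio.1 hL'])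
  -- differentiate the finite sum termwise
  have hterm : ∀ n ∈ Finset.range N, HasDerivAt
      (fun L' : ℝ ↦ ((Λ n : ℝ) : ℂ) * χ n * (quadWeight L' (Real.log n) : ℂ) * (n : ℂ) ^ (-(1 / 2 : ℂ)))
      (((Λ n : ℝ) : ℂ) * χ n * ((max (L - Real.log n) 0 : ℝ) : ℂ) * (n : ℂ) ^ (-(1 / 2 : ℂ))) L := by
    intro n _
    have h := (hasDerivAt_quadWeight_left (Real.log n) L).ofReal_comp
    exact ((h.const_mul (((Λ n : ℝ) : ℂ) * χ n)).mul_const ((n : ℂ) ^ (-(1 / 2 : ℂ)))).congr_deriv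
      (by ring)
  have hsum := HasDerivAt.fun_sum hterm
  refine (hsum.congr_of_eventuallyEq hev).congr_deriv ?_
  -- identify the derivative with `f_χ(e^L)`
  rw [halfLineSum]
  have hfloor : ⌊rexp L⌋₊ < N := by
    have h1 : (⌊rexp L⌋₊ : ℝ) ≤ rexp L := Nat.floor_le (Real.exp_nonneg _)
    have h2 : rexp L < rexp (L + 1) := Real.exp_lt_exp.2 (by linarith)
    exact_mod_cast (h1.trans_lt (h2.trans_le hN))
  have hsub : Finset.Icc 1 ⌊rexp L⌋₊ ⊆ Finset.range N := by
    intro n hn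
    rw [Finset.mem_Icc] at hn
    rw [Finset.mem_range]
    omega
  rw [← Finset.sum_subset hsub]
  · refine Finset.sum_congr rfl fun n hn ↦ ?_
    rw [Finset.mem_Icc] at hn
    have hn0 : (0 : ℝ) < n := by exact_mod_cast hn.1
    have hnle : (n : ℝ) ≤ rexp L := by
      have := Nat.floor_le (Real.exp_nonneg L)
      exact le_trans (by exact_mod_cast hn.2) this
    have hlog : Real.log n ≤ L := by
      have := Real.log_le_log hn0 hnle
      rwa [Real.log_exp] at this
    rw [max_eq_left (sub_nonneg.2 hlog), natCast_cpow_neg_half hn.1,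
      Real.log_div (Real.exp_pos L).ne' hn0.ne', Real.log_exp]
    push_cast
    ring
  · intro n hn hn'
    rw [Finset.mem_range] at hn
    rw [Finset.mem_Icc, not_and_or, not_le, not_le] at hn'
    rcases hn' with h0 | hbig
    · have : n = 0 := by omega
      subst this
      simp
    · -- `n > e^L`: the weight vanishes
      have hn1 : 1 ≤ n := by
        have := Nat.lt_of_lt_of_le (Nat.zero_lt_succ _) (Nat.succ_le_of_lt hbig)
        omega
      have hn0 : (0 : ℝ) < n := by exact_mod_cast hn1
      have hgt : rexp L < n := by
        have := Nat.lt_of_floor_lt hbig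
        exact_mod_cast this
      have hlog : L ≤ Real.log n := by
        have := Real.log_le_log (Real.exp_pos L) hgt.le
        rwa [Real.log_exp] at this
      rw [max_eq_right (sub_nonpos.2 hlog)]
      simp


variable [NeZero q] {χ : DirichletCharacter ℂ q}

/-- `|Re(½ − ρ)| ≤ ½` for a non-trivial zero. [folklore] -/
private theorem abs_re_half_sub_le (ρ : charNontrivialZeros χ) : |((1 / 2 : ℂ) - (ρ : ℂ)).re| ≤ 1 / 2 := by
  have h1 := ρ.2.2.1
  have h2 := ρ.2.2.2
  rw [abs_le, Complex.sub_re]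
  norm_num
  constructor <;> linarith

/-- For a trivial zero `τ`: `Re(½ − τ) ≥ ½`, in particular `½ − τ ≠ 0`. [folklore] -/
private theorem half_le_re_half_sub_triv {hχ : χ ≠ 1} {τ : ℂ} (hτ : τ ∈ charTrivialZeroFinset hχ) :
    1 / 2 ≤ ((1 / 2 : ℂ) - τ).re := by
  have h := (mem_charTrivialZeroFinset.1 hτ).2.2.1
  simp only [Complex.sub_re]
  norm_num
  linarith

/-- `½ − τ ≠ 0` for a trivial zero `τ`. [folklore] -/
private theorem half_sub_triv_ne_zero {hχ : χ ≠ 1} {τ : ℂ} (hτ : τ ∈ charTrivialZeroFinset hχ) :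
    (1 / 2 : ℂ) - τ ≠ 0 := by
  intro h
  have := half_le_re_half_sub_triv hτ
  rw [h, Complex.zero_re] at this
  linarith

/-- `T` is differentiable with `T' = trivSideDeriv`. [folklore] -/
private theorem hasDerivAt_trivSide (hχ : χ ≠ 1) (L : ℝ) :
    HasDerivAt (trivSide hχ) (trivSideDeriv hχ L) L := by
  unfold trivSide trivSideDeriv
  exact HasDerivAt.fun_sum fun τ hτ ↦ (hasDerivAt_quadLaplace₀ (half_sub_triv_ne_zero hτ) L).const_mul _

/-- `½ − (−5/2 + iy) = 3 − iy`: real part `3`, never zero, `‖·‖² = 9 + y²`. [folklore] -/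
private theorem half_sub_leftPt (y : ℝ) : (1 / 2 : ℂ) - leftPt y = (3 : ℂ) - y * I := by
  simp only [leftPt]; push_cast; ring

/-- `Re(½ − (−5/2 + iy)) = 3`. [folklore] -/
private theorem re_half_sub_leftPt (y : ℝ) : ((1 / 2 : ℂ) - leftPt y).re = 3 := by
  rw [half_sub_leftPt]; simp

/-- `½ − (−5/2 + iy) ≠ 0`. [folklore] -/
private theorem half_sub_leftPt_ne_zero (y : ℝ) : (1 / 2 : ℂ) - leftPt y ≠ 0 := by
  intro h
  have := congrArg Complex.re h
  rw [re_half_sub_leftPt, Complex.zero_re] at this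
  norm_num at this

/-- `‖½ − (−5/2 + iy)‖² = 9 + y²`. [folklore] -/
private theorem norm_sq_half_sub_leftPt (y : ℝ) : ‖(1 / 2 : ℂ) - leftPt y‖ ^ 2 = 3 ^ 2 + (0 - y) ^ 2 := by
  rw [half_sub_leftPt, Complex.sq_norm, Complex.normSq_apply]
  simp; ring

/-- `y ↦ −5/2 + iy` is continuous. [folklore] -/
private theorem continuous_leftPt : Continuous leftPt := by
  unfold leftPt; fun_prop

/-- For `L ≥ 0` the tree's remainder `J_χ` of the admissible weight `h_L` at `s = ½` is `J(L)`. [folklore] -/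
private theorem charEFRemainder_quadWeight {L : ℝ} (hL : 0 ≤ L) :
    charEFRemainder χ (quadWeight L) (1 / 2) = remSide χ L := by
  rw [charEFRemainder, remSide]
  congr 1
  refine integral_congr_ae (ae_of_all _ fun y ↦ ?_)
  change charEFIntegrand χ (quadWeight L) (1 / 2) (leftPt y) = remIntegrand χ L y
  rw [charEFIntegrand, remIntegrand, fordLaplace₀_quadWeight hL (half_sub_leftPt_ne_zero y)]

/-- `y ↦ (L'/L)(−5/2 + iy, χ)` is continuous (primitive `χ` mod `q > 1`: `L ≠ 0` on the line). [folklore] -/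
private theorem continuous_logDerivL_leftPt (hprim : χ.IsPrimitive) (hq : 1 < q) :
    Continuous fun y : ℝ ↦ deriv χ.LFunction (leftPt y) / χ.LFunction (leftPt y) := by
  have hχ : χ ≠ 1 := ne_one_of_isPrimitive hprim hq
  obtain ⟨A, -, hA⟩ := exists_norm_logDeriv_LFunction_leftLine_le
  refine continuous_iff_continuousAt.2 fun y ↦ ?_
  have hL : χ.LFunction (leftPt y) ≠ 0 := (hA q χ hprim hq y).1
  have han : AnalyticAt ℂ χ.LFunction (leftPt y) :=
    (DirichletCharacter.differentiable_LFunction hχ).analyticAt _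
  have h1 : ContinuousAt (fun w ↦ deriv χ.LFunction w / χ.LFunction w) (leftPt y) :=
    han.deriv.continuousAt.div han.continuousAt hL
  exact ContinuousAt.comp (x := y) h1 continuous_leftPt.continuousAt

/-- `y ↦ H₀(3 − iy; L)` is continuous. [folklore] -/
private theorem continuous_quadLaplace₀_leftPt (L : ℝ) :
    Continuous fun y : ℝ ↦ quadLaplace₀ (1 / 2 - leftPt y) L := by
  unfold quadLaplace₀
  have hz : Continuous fun y : ℝ ↦ (1 / 2 : ℂ) - leftPt y := continuous_const.sub continuous_leftPt
  have hne : ∀ y, (1 / 2 : ℂ) - leftPt y ≠ 0 := half_sub_leftPt_ne_zero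
  refine Continuous.div ?_ (hz.pow 2) (fun y ↦ pow_ne_zero _ (hne y))
  refine continuous_const.add (Continuous.div ?_ hz hne)
  exact continuous_const.sub (Complex.continuous_exp.comp ((hz.mul continuous_const).neg))

/-- `y ↦ ∂_L H₀(3 − iy; L)` is continuous. [folklore] -/
private theorem continuous_quadLaplace₀Deriv_leftPt (L : ℝ) :
    Continuous fun y : ℝ ↦ quadLaplace₀Deriv (1 / 2 - leftPt y) L := by
  unfold quadLaplace₀Deriv
  have hz : Continuous fun y : ℝ ↦ (1 / 2 : ℂ) - leftPt y := continuous_const.sub continuous_leftPt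
  have hne : ∀ y, (1 / 2 : ℂ) - leftPt y ≠ 0 := half_sub_leftPt_ne_zero
  refine Continuous.div ?_ (hz.pow 2) (fun y ↦ pow_ne_zero _ (hne y))
  exact (continuous_const.sub (Complex.continuous_exp.comp ((hz.mul continuous_const).neg))).neg

/-- `F(L, ·)` is continuous. [folklore] -/
private theorem continuous_remIntegrand (hprim : χ.IsPrimitive) (hq : 1 < q) (L : ℝ) :
    Continuous fun y : ℝ ↦ remIntegrand χ L y :=
  ((continuous_logDerivL_leftPt hprim hq).neg).mul (continuous_quadLaplace₀_leftPt L)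

/-- `∂_L F(L, ·)` is continuous. [folklore] -/
private theorem continuous_remIntegrandDeriv (hprim : χ.IsPrimitive) (hq : 1 < q) (L : ℝ) :
    Continuous fun y : ℝ ↦ remIntegrandDeriv χ L y :=
  ((continuous_logDerivL_leftPt hprim hq).neg).mul (continuous_quadLaplace₀Deriv_leftPt L)

/-- `F(L, ·)` is integrable on `ℝ` for `L ≥ 0` (the tree's `integrable_charIntegrand_left`). [folklore] -/
private theorem integrable_remIntegrand (hprim : χ.IsPrimitive) (hq : 1 < q) {L : ℝ} (hL : 0 ≤ L) :
    Integrable fun y : ℝ ↦ remIntegrand χ L y := by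
  have h := integrable_charIntegrand_left hprim hq (isSmoothedEFTest_quadWeight hL) (s := 1 / 2)
    (by norm_num)
  refine h.congr (ae_of_all _ fun y ↦ ?_)
  change charEFIntegrand χ (quadWeight L) (1 / 2) (leftPt y) = remIntegrand χ L y
  rw [charEFIntegrand, remIntegrand, fordLaplace₀_quadWeight hL (half_sub_leftPt_ne_zero y)]

/-- **Differentiation under the integral sign**: for `L₀ ≥ 0`, `L ↦ ∫ F(L, y) dy` has derivative
`∫ ∂_L F(L₀, y) dy` at `L₀`; the derivative integrand is dominated on `|L − L₀| < 1` by
`(1 + e^{3(|L₀|+1)})(A + log q + 2 log(1 + |y|))/(9 + y²)` (`|L'/L(−5/2 + iy)| ≤ A + log q + 2 log(1+|y|)`,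
the tree's `exists_norm_logDeriv_LFunction_leftLine_le`). [folklore] -/
private theorem hasDerivAt_integral_remIntegrand (hprim : χ.IsPrimitive) (hq : 1 < q) {L₀ : ℝ} (hL₀ : 0 ≤ L₀) :
    Integrable (fun y : ℝ ↦ remIntegrandDeriv χ L₀ y) ∧
    HasDerivAt (fun L : ℝ ↦ ∫ y : ℝ, remIntegrand χ L y) (∫ y : ℝ, remIntegrandDeriv χ L₀ y) L₀ := by
  obtain ⟨A, hA0, hA⟩ := exists_norm_logDeriv_LFunction_leftLine_le
  have hq0 : 0 ≤ Real.log q := Real.log_natCast_nonneg q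
  set K : ℝ := 1 + rexp (3 * (|L₀| + 1)) with hK
  set bound : ℝ → ℝ := fun y ↦ K * ((A + Real.log q + 2 * Real.log (1 + |y|)) / (3 ^ 2 + (0 - y) ^ 2))
    with hbound
  have hbi : Integrable bound :=
    (SmoothedEF.integrable_left_majorant' (A := A + Real.log q) (t := 0) (by positivity)
      (by norm_num : (0 : ℝ) < 3)).const_mul K
  refine hasDerivAt_integral_of_dominated_loc_of_deriv_le (s := Set.Ioo (L₀ - 1) (L₀ + 1))
    (Ioo_mem_nhds (by linarith) (by linarith))
    (Eventually.of_forall fun L ↦ (continuous_remIntegrand hprim hq L).aestronglyMeasurable)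
    (integrable_remIntegrand hprim hq hL₀)
    (continuous_remIntegrandDeriv hprim hq L₀).aestronglyMeasurable
    (ae_of_all _ fun y L hL ↦ ?_) hbi
    (ae_of_all _ fun y L _ ↦ ?_)
  · -- the domination
    rw [Set.mem_Ioo] at hL
    rw [remIntegrandDeriv, norm_mul, norm_neg, hbound]
    obtain ⟨-, hb⟩ := hA q χ hprim hq y
    have hlog0 : 0 ≤ Real.log (1 + |y|) := Real.log_nonneg (by linarith [abs_nonneg y])
    have hC1 : 0 ≤ A + Real.log q + 2 * Real.log (1 + |y|) := by positivity
    have hq' := norm_quadLaplace₀Deriv_le ((1 / 2 : ℂ) - leftPt y) L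
    rw [re_half_sub_leftPt, norm_sq_half_sub_leftPt] at hq'
    have hexp : rexp (-(3 * L)) ≤ rexp (3 * (|L₀| + 1)) := by
      rw [Real.exp_le_exp]
      have : -L ≤ |L₀| + 1 := by
        have h1 : L₀ - 1 < L := hL.1
        have h2 : -L₀ ≤ |L₀| := neg_le_abs L₀
        linarith
      linarith
    have hq'' : ‖quadLaplace₀Deriv (1 / 2 - leftPt y) L‖ ≤ K / (3 ^ 2 + (0 - y) ^ 2) := by
      refine hq'.trans ?_
      rw [hK]
      gcongr
    change ‖deriv χ.LFunction (leftPt y) / χ.LFunction (leftPt y)‖ *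
        ‖quadLaplace₀Deriv (1 / 2 - leftPt y) L‖ ≤ _
    calc ‖deriv χ.LFunction (leftPt y) / χ.LFunction (leftPt y)‖ * ‖quadLaplace₀Deriv (1 / 2 - leftPt y) L‖
        ≤ (A + Real.log q + 2 * Real.log (1 + |y|)) * (K / (3 ^ 2 + (0 - y) ^ 2)) :=
          mul_le_mul hb hq'' (norm_nonneg _) hC1
      _ = K * ((A + Real.log q + 2 * Real.log (1 + |y|)) / (3 ^ 2 + (0 - y) ^ 2)) := by ring
  · -- pointwise derivative
    exact (hasDerivAt_quadLaplace₀ (half_sub_leftPt_ne_zero y) L).const_mul _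

/-- **`J'`**: for `L₀ ≥ 0`, `J` (as `remSide`) has derivative `remSideDeriv χ L₀` at `L₀`. [folklore] -/
private theorem hasDerivAt_remSide (hprim : χ.IsPrimitive) (hq : 1 < q) {L₀ : ℝ} (hL₀ : 0 ≤ L₀) :
    HasDerivAt (remSide χ) (remSideDeriv χ L₀) L₀ := by
  unfold remSide remSideDeriv
  exact (hasDerivAt_integral_remIntegrand hprim hq hL₀).2.const_mul _

/-! ## §8 A zero of `L(s, χ)` at `s = ½` of order `m`: the order-`m` exact formulas (Suzuki (4.4'), (4.5'))

When `L(½, χ) = 0` (order `m ≥ 1`), the printed proof replaces (4.4)–(4.5) by (4.4')–(4.5'): the coefficient of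
`f(0)` becomes the constant term `lim_{s→½}[(L'/L)(s, χ) − m/(s − ½)]` of `L'/L` at `½`, and the zero at `½`
contributes `m·F(0)` (`F` the full Laplace transform of the weight; for `h_L`, `F(0) = L³/6`, whose `L`-derivative
`mL²/2` is the printed `−(m/2)(log x)²`). In Lean the tree's zero term `m(ρ)·fordLaplace₀ f (½ − ρ)` at `ρ = ½` is
`m·(fordLaplace f 0 − f(0)/0) = m·fordLaplace f 0` (division by zero is zero), so the order-`m` formula below has
literally the shape of `charFordK_eq_explicit` with `(L'/L)(½, χ)` replaced by that constant term. It is obtained from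
the tree's formula at `s = ½ + δ`, `δ → 0⁺` (all other terms depend continuously on `s`). -/

section OrderM

/-- **The regular part of `L'/L` at `½`**: for `χ ≠ χ₀` there is `c₀` with
`(L'/L)(s, χ) − m/(s − ½) → c₀` as `s → ½` (`m` the order of `L(s, χ)` at `½`; `L = (s − ½)^m g`, `c₀ = (g'/g)(½)`).
This is the constant `lim_{s→1/2}[(L'/L)(s, χ) − m/(s − 1/2)]` of the printed (4.5'). [cite: Suzuki2025Chebyshev, §4.1 (4.5')] -/
theorem exists_tendsto_logDeriv_sub_polar (hχ : χ ≠ 1) :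
    ∃ c₀ : ℂ, Tendsto (fun s ↦ logDeriv χ.LFunction s - (DirichletDisc.zeroOrder χ (1 / 2) : ℂ) / (s - 1 / 2))
      (𝓝[≠] (1 / 2)) (𝓝 c₀) := by
  set m := DirichletDisc.zeroOrder χ (1 / 2) with hm
  have han : AnalyticAt ℂ χ.LFunction (1 / 2) := (DirichletCharacter.differentiable_LFunction hχ).analyticAt _
  have hord : analyticOrderAt χ.LFunction (1 / 2) = m := by
    rw [hm, DirichletDisc.zeroOrder]
    exact (Nat.cast_analyticOrderNatAt (DirichletDisc.analyticOrderAt_LFunction_ne_top χ hχ _)).symm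
  obtain ⟨g, hg, hg0, hfg⟩ := han.analyticOrderAt_eq_natCast.1 hord
  refine ⟨logDeriv g (1 / 2), ?_⟩
  have hgc : ContinuousAt g (1 / 2) := hg.continuousAt
  have hg_ne : ∀ᶠ z in 𝓝 (1 / 2 : ℂ), g z ≠ 0 := hgc.eventually_ne hg0
  have hga : ∀ᶠ z in 𝓝 (1 / 2 : ℂ), AnalyticAt ℂ g z := hg.eventually_analyticAt
  have hev : ∀ᶠ s in 𝓝[≠] (1 / 2 : ℂ),
      logDeriv g s = logDeriv χ.LFunction s - (m : ℂ) / (s - 1 / 2) := by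
    have h1 : ∀ᶠ s in 𝓝 (1 / 2 : ℂ), ∀ᶠ z in 𝓝 s, χ.LFunction z = (z - 1 / 2) ^ m • g z :=
      hfg.eventually_nhds
    filter_upwards [mem_nhdsWithin_of_mem_nhds (h1.and (hg_ne.and hga)), self_mem_nhdsWithin]
      with s hs hs'
    obtain ⟨hloc, hgs, hgas⟩ := hs
    have hs'' : s - 1 / 2 ≠ 0 := sub_ne_zero.2 hs'
    have hpow : (s - 1 / 2) ^ m ≠ 0 := pow_ne_zero _ hs''
    have hderiv : logDeriv χ.LFunction s = logDeriv (fun z : ℂ ↦ (z - 1 / 2) ^ m * g z) s := by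
      have hloc' : χ.LFunction =ᶠ[𝓝 s] fun z : ℂ ↦ (z - 1 / 2) ^ m * g z :=
        hloc.mono fun z hz ↦ by rw [hz, smul_eq_mul]
      rw [logDeriv_apply, logDeriv_apply, hloc'.deriv_eq, hloc'.self_of_nhds]
    have hprod : logDeriv (fun z : ℂ ↦ (z - 1 / 2) ^ m * g z) s =
        logDeriv (fun z : ℂ ↦ (z - 1 / 2) ^ m) s + logDeriv g s := by
      have := logDeriv_mul (f := fun z : ℂ ↦ (z - 1 / 2) ^ m) (g := g) s hpow hgs (by fun_prop)
        hgas.differentiableAt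
      exact this
    have hpole : logDeriv (fun z : ℂ ↦ (z - 1 / 2) ^ m) s = (m : ℂ) / (s - 1 / 2) := by
      rw [show (fun z : ℂ ↦ (z - 1 / 2) ^ m) = (fun z : ℂ ↦ z ^ m) ∘ (fun z : ℂ ↦ z - 1 / 2) by rfl,
        logDeriv_comp (by fun_prop) (by fun_prop), logDeriv_pow, deriv_sub_const, deriv_id'', mul_one]
    rw [hderiv, hprod, hpole]
    ring
  have hlim : Tendsto (logDeriv g) (𝓝[≠] (1 / 2)) (𝓝 (logDeriv g (1 / 2))) := by
    have hc : ContinuousAt (logDeriv g) (1 / 2) := by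
      have h : logDeriv g = fun z ↦ deriv g z / g z := by
        funext z; exact logDeriv_apply g z
      rw [h]
      exact hg.deriv.continuousAt.div hgc hg0
    exact hc.tendsto.mono_left nhdsWithin_le_nhds
  exact hlim.congr' hev

/-- The non-trivial zeros OTHER than `s` stay at a positive distance from `s` (the zeros are isolated:
`lfunctionZeroBox` is finite). [folklore] -/
private theorem exists_dist_charZeros_ge' (hχ : χ ≠ 1) (s : ℂ) :
    ∃ d : ℝ, 0 < d ∧ d ≤ 1 ∧ ∀ ρ ∈ charNontrivialZeros χ, ρ ≠ s → d ≤ ‖s - ρ‖ := by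
  classical
  have hfin := lfunctionZeroBox_finite hχ (|s.im| + 1)
  set A : Finset ℝ := insert 1 ((hfin.toFinset.filter (· ≠ s)).image fun ρ ↦ ‖s - ρ‖) with hA
  have hne : A.Nonempty := ⟨1, Finset.mem_insert_self _ _⟩
  have hpos : ∀ a ∈ A, 0 < a := by
    intro a ha
    rw [hA, Finset.mem_insert, Finset.mem_image] at ha
    rcases ha with rfl | ⟨ρ, hρ, rfl⟩
    · exact one_pos
    · rw [Finset.mem_filter] at hρ
      exact norm_pos_iff.2 (sub_ne_zero.2 (Ne.symm hρ.2))
  refine ⟨A.min' hne, hpos _ (Finset.min'_mem _ _), Finset.min'_le _ _ (Finset.mem_insert_self _ _),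
    fun ρ hρ hρs ↦ ?_⟩
  by_cases hγ : |ρ.im| ≤ |s.im| + 1
  · refine Finset.min'_le _ _ ?_
    rw [hA, Finset.mem_insert, Finset.mem_image]
    refine Or.inr ⟨ρ, ?_, rfl⟩
    rw [Finset.mem_filter, Set.Finite.mem_toFinset, lfunctionZeroBox_eq_inter]
    exact ⟨⟨hρ, hγ⟩, hρs⟩
  · push Not at hγ
    have h1 : (1 : ℝ) ≤ ‖s - ρ‖ := by
      have := Complex.abs_im_le_norm (s - ρ)
      rw [sub_im] at this
      have h2 : |ρ.im| - |s.im| ≤ |s.im - ρ.im| := by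
        have := abs_sub_abs_le_abs_sub ρ.im s.im
        rwa [abs_sub_comm] at this
      linarith
    exact (Finset.min'_le _ _ (Finset.mem_insert_self _ _)).trans h1

/-- **The summable majorant without `L(½, χ) ≠ 0`**: `Σ_ρ m(ρ)/‖½ − ρ‖² < ∞` for every primitive `χ` mod `q > 1`
(in Lean the term of a zero `ρ = ½` is `m/0 = 0`; the other zeros stay at distance `≥ d > 0` from `½`).
[cite: Suzuki2025Chebyshev, §2.3 (2.12)] -/
theorem summable_zeroOrder_div_norm_sq' (hprim : χ.IsPrimitive) (hq : 1 < q) :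
    Summable fun ρ : charNontrivialZeros χ ↦
      (DirichletDisc.zeroOrder χ (ρ : ℂ) : ℝ) / ‖(1 / 2 : ℂ) - ρ‖ ^ 2 := by
  have hχ : χ ≠ 1 := ne_one_of_isPrimitive hprim hq
  obtain ⟨d, hd0, -, hd⟩ := exists_dist_charZeros_ge' hχ (1 / 2)
  set C : ℝ := 1 / d ^ 2 + 1 with hC
  refine Summable.of_nonneg_of_le (fun ρ ↦ by positivity) (fun ρ ↦ ?_)
    ((summable_zeroOrder_div_one_add_sq hprim hq).mul_left C)
  have hm : (0 : ℝ) ≤ DirichletDisc.zeroOrder χ (ρ : ℂ) := Nat.cast_nonneg _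
  by_cases hρ : (ρ : ℂ) = 1 / 2
  · rw [hρ, sub_self, norm_zero, zero_pow two_ne_zero, div_zero]
    positivity
  have hdρ : d ≤ ‖(1 / 2 : ℂ) - ρ‖ := hd _ ρ.2 hρ
  have hpos : 0 < ‖(1 / 2 : ℂ) - ρ‖ ^ 2 := by
    have : 0 < ‖(1 / 2 : ℂ) - ρ‖ := hd0.trans_le hdρ
    positivity
  have him : (ρ : ℂ).im ^ 2 ≤ ‖(1 / 2 : ℂ) - ρ‖ ^ 2 := by
    have h := Complex.abs_im_le_norm ((1 / 2 : ℂ) - ρ)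
    have him' : ((1 / 2 : ℂ) - ρ).im = -(ρ : ℂ).im := by simp
    rw [him', abs_neg] at h
    nlinarith [abs_nonneg ((ρ : ℂ).im), sq_abs ((ρ : ℂ).im)]
  have hd2 : d ^ 2 ≤ ‖(1 / 2 : ℂ) - ρ‖ ^ 2 := by nlinarith [norm_nonneg ((1 / 2 : ℂ) - ρ)]
  have hkey : 1 + (ρ : ℂ).im ^ 2 ≤ C * ‖(1 / 2 : ℂ) - ρ‖ ^ 2 := by
    have h1 : (1 : ℝ) ≤ 1 / d ^ 2 * ‖(1 / 2 : ℂ) - ρ‖ ^ 2 := by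
      rw [div_mul_eq_mul_div, one_mul, le_div_iff₀ (by positivity), one_mul]
      exact hd2
    calc 1 + (ρ : ℂ).im ^ 2 ≤ 1 / d ^ 2 * ‖(1 / 2 : ℂ) - ρ‖ ^ 2 + ‖(1 / 2 : ℂ) - ρ‖ ^ 2 := by linarith
      _ = C * ‖(1 / 2 : ℂ) - ρ‖ ^ 2 := by rw [hC]; ring
  rw [div_le_iff₀ hpos]
  calc (DirichletDisc.zeroOrder χ (ρ : ℂ) : ℝ)
      = (DirichletDisc.zeroOrder χ (ρ : ℂ) : ℝ) / (1 + (ρ : ℂ).im ^ 2) * (1 + (ρ : ℂ).im ^ 2) := by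
        field_simp
    _ ≤ (DirichletDisc.zeroOrder χ (ρ : ℂ) : ℝ) / (1 + (ρ : ℂ).im ^ 2) * (C * ‖(1 / 2 : ℂ) - ρ‖ ^ 2) :=
        mul_le_mul_of_nonneg_left hkey (by positivity)
    _ = C * ((DirichletDisc.zeroOrder χ (ρ : ℂ) : ℝ) / (1 + (ρ : ℂ).im ^ 2)) * ‖(1 / 2 : ℂ) - ρ‖ ^ 2 := by
        ring

variable {f p p' p'' : ℝ → ℝ} {x₀ : ℝ}

/-- `F₀ = F − f(0)/z` is continuous at every `z ≠ 0` (`F` is entire). [folklore] -/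
private theorem continuousAt_fordLaplace₀ (h : IsSmoothedEFTest f p p' p'' x₀) {z : ℂ} (hz : z ≠ 0) :
    ContinuousAt (fordLaplace₀ f) z := by
  have hF := (differentiable_fordLaplace h.cont h.x₀_nonneg h.eq_zero).continuous.continuousAt (x := z)
  have h2 : ContinuousAt (fun z : ℂ ↦ (f 0 : ℂ) / z) z := continuousAt_const.div continuousAt_id hz
  exact hF.sub h2

omit [NeZero q] in
/-- `s ↦ K_{f,χ}(s)` is continuous (a finite sum of `n^{-s}`-terms). [folklore] -/
private theorem continuous_charFordK (χ : DirichletCharacter ℂ q) (h : IsSmoothedEFTest f p p' p'' x₀) :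
    Continuous fun s : ℂ ↦ charFordK χ f s := by
  obtain ⟨N, hN⟩ : ∃ N : ℕ, rexp x₀ ≤ N := exists_nat_ge _
  have hN1 : 1 ≤ N := by
    have : (0 : ℝ) < N := (Real.exp_pos _).trans_le hN
    exact_mod_cast this
  have hlogN : x₀ ≤ Real.log N := by
    have := Real.log_le_log (Real.exp_pos _) hN
    rwa [Real.log_exp] at this
  have heq : (fun s : ℂ ↦ charFordK χ f s) = fun s ↦ ∑ n ∈ Finset.range N,
      ((Λ n : ℝ) : ℂ) * χ n * (f (Real.log n) : ℂ) * (n : ℂ) ^ (-s) :=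
    funext fun s ↦ charFordK_eq_sum χ h.eq_zero hN1 hlogN s
  rw [heq]
  refine continuous_finsetSum _ fun n _ ↦ ?_
  rcases Nat.eq_zero_or_pos n with rfl | hn
  · simp only [ArithmeticFunction.map_zero, Complex.ofReal_zero, zero_mul]
    exact continuous_const
  · have hn0 : (n : ℂ) ≠ 0 := by exact_mod_cast hn.ne'
    exact continuous_const.mul (continuous_neg.const_cpow (Or.inl hn0))

/-- **Uniform control of the zero terms near `s = ½`**: if `d ≤ ‖½ − ρ‖` (`0 < d ≤ 1`, `ρ` in the critical strip)
and `|δ| ≤ d/2`, then `½ + δ − ρ ≠ 0` and `‖F₀(½ + δ − ρ)‖ ≤ 4D/‖½ − ρ‖²`. [folklore] -/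
private theorem norm_zeroTerm_le (h : IsSmoothedEFTest f p p' p'' x₀) {d : ℝ} (hd0 : 0 < d) (hd1 : d ≤ 1)
    {ρ : ℂ} (hρ : ρ ∈ charNontrivialZeros χ) (hdρ : d ≤ ‖(1 / 2 : ℂ) - ρ‖) {δ : ℝ} (hδ : |δ| ≤ d / 2) :
    (1 / 2 : ℂ) + δ - ρ ≠ 0 ∧
      ‖fordLaplace₀ f (1 / 2 + δ - ρ)‖ ≤ 4 * SmoothedEF.decayConst p' p'' x₀ / ‖(1 / 2 : ℂ) - ρ‖ ^ 2 := by
  have hD0 : 0 ≤ SmoothedEF.decayConst p' p'' x₀ := SmoothedEF.decayConst_nonneg h.x₀_nonneg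
  have heq : (1 / 2 : ℂ) + δ - ρ = ((1 / 2 : ℂ) - ρ) + δ := by ring
  have hlow : ‖(1 / 2 : ℂ) - ρ‖ / 2 ≤ ‖(1 / 2 : ℂ) + δ - ρ‖ := by
    have h1 := norm_sub_norm_le ((1 / 2 : ℂ) - ρ) (-(δ : ℂ))
    rw [norm_neg, sub_neg_eq_add, Complex.norm_real, Real.norm_eq_abs] at h1
    rw [heq]
    linarith
  have hpos : 0 < ‖(1 / 2 : ℂ) - ρ‖ := hd0.trans_le hdρ
  have hne : (1 / 2 : ℂ) + δ - ρ ≠ 0 := by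
    intro h0
    rw [h0, norm_zero] at hlow
    linarith
  refine ⟨hne, ?_⟩
  have hre : -2 ≤ ((1 / 2 : ℂ) + δ - ρ).re := by
    have h1 := hρ.2.2
    have h2 : -(1 : ℝ) / 2 ≤ δ := by
      have := (abs_le.1 hδ).1; linarith
    simp only [Complex.add_re, Complex.sub_re, Complex.ofReal_re]
    norm_num
    linarith
  refine (SmoothedEF.norm_fordLaplace₀_le h hne hre).trans ?_
  have hsq : (‖(1 / 2 : ℂ) - ρ‖ / 2) ^ 2 ≤ ‖(1 / 2 : ℂ) + δ - ρ‖ ^ 2 :=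
    pow_le_pow_left₀ (by positivity) hlow 2
  calc SmoothedEF.decayConst p' p'' x₀ / ‖(1 / 2 : ℂ) + δ - ρ‖ ^ 2
      ≤ SmoothedEF.decayConst p' p'' x₀ / (‖(1 / 2 : ℂ) - ρ‖ / 2) ^ 2 :=
        div_le_div_of_nonneg_left hD0 (by positivity) hsq
    _ = 4 * SmoothedEF.decayConst p' p'' x₀ / ‖(1 / 2 : ℂ) - ρ‖ ^ 2 := by
        field_simp
        ring

/-- **The zero sum minus the zero at `½`, near `s = ½`**: with `ρ₀ = ½` a zero, the punctured sum
`δ ↦ Σ'_{ρ ≠ ρ₀} m(ρ) F₀(½ + δ − ρ)` is continuous on `[−d/2, d/2]` (uniform majorant `4D·m(ρ)/‖½ − ρ‖²`,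
`summable_zeroOrder_div_norm_sq'`). [folklore] -/
private theorem continuousOn_zeroSum_punctured (hprim : χ.IsPrimitive) (hq : 1 < q)
    (h : IsSmoothedEFTest f p p' p'' x₀) (ρ₀ : charNontrivialZeros χ) (hρ₀ : (ρ₀ : ℂ) = 1 / 2)
    {d : ℝ} (hd0 : 0 < d) (hd1 : d ≤ 1) (hd : ∀ ρ ∈ charNontrivialZeros χ, ρ ≠ 1 / 2 → d ≤ ‖(1 / 2 : ℂ) - ρ‖) :
    ContinuousOn (fun δ : ℝ ↦ ∑' ρ : charNontrivialZeros χ,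
      if ρ = ρ₀ then (0 : ℂ) else (DirichletDisc.zeroOrder χ (ρ : ℂ) : ℂ) * fordLaplace₀ f (1 / 2 + δ - ρ))
      (Icc (-(d / 2)) (d / 2)) := by
  classical
  set D := SmoothedEF.decayConst p' p'' x₀ with hD
  have hD0 : 0 ≤ D := SmoothedEF.decayConst_nonneg h.x₀_nonneg
  have hδabs : ∀ δ ∈ Icc (-(d / 2)) (d / 2), |δ| ≤ d / 2 := fun δ hδ ↦ abs_le.2 ⟨hδ.1, hδ.2⟩
  refine continuousOn_tsum
    (u := fun ρ : charNontrivialZeros χ ↦ 4 * D * ((DirichletDisc.zeroOrder χ (ρ : ℂ) : ℝ) / ‖(1 / 2 : ℂ) - ρ‖ ^ 2))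
    (fun ρ ↦ ?_) ((summable_zeroOrder_div_norm_sq' hprim hq).mul_left (4 * D)) (fun ρ δ hδ ↦ ?_)
  · by_cases hρ : ρ = ρ₀
    · simp only [hρ, if_true]
      exact continuousOn_const
    · simp only [hρ, if_false]
      have hne : (ρ : ℂ) ≠ 1 / 2 := fun h' ↦ hρ (Subtype.ext (h'.trans hρ₀.symm))
      have hdρ := hd _ ρ.2 hne
      intro δ hδ
      have hz := (norm_zeroTerm_le (χ := χ) h hd0 hd1 ρ.2 hdρ (hδabs δ hδ)).1
      have hlin : ContinuousAt (fun δ : ℝ ↦ (1 / 2 : ℂ) + δ - ρ) δ := by fun_prop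
      exact (continuousAt_const.mul ((continuousAt_fordLaplace₀ h hz).comp_of_eq hlin rfl)).continuousWithinAt
  · by_cases hρ : ρ = ρ₀
    · simp only [hρ, if_true, norm_zero]
      exact mul_nonneg (mul_nonneg (by norm_num) hD0) (by positivity)
    · simp only [hρ, if_false]
      have hne : (ρ : ℂ) ≠ 1 / 2 := fun h' ↦ hρ (Subtype.ext (h'.trans hρ₀.symm))
      have hdρ := hd _ ρ.2 hne
      have hb := (norm_zeroTerm_le (χ := χ) h hd0 hd1 ρ.2 hdρ (hδabs δ hδ)).2
      have hm : (0 : ℝ) ≤ DirichletDisc.zeroOrder χ (ρ : ℂ) := Nat.cast_nonneg _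
      rw [norm_mul, Complex.norm_natCast]
      calc (DirichletDisc.zeroOrder χ (ρ : ℂ) : ℝ) * ‖fordLaplace₀ f (1 / 2 + δ - ρ)‖
          ≤ (DirichletDisc.zeroOrder χ (ρ : ℂ) : ℝ) * (4 * D / ‖(1 / 2 : ℂ) - ρ‖ ^ 2) :=
            mul_le_mul_of_nonneg_left hb hm
        _ = 4 * D * ((DirichletDisc.zeroOrder χ (ρ : ℂ) : ℝ) / ‖(1 / 2 : ℂ) - ρ‖ ^ 2) := by ring

/-- **The remainder `J_χ(f, s)` is continuous in `s` at `s = ½`** (dominated convergence: for `‖s − ½‖ < 1`,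
`‖G(−5/2 + iy)‖ ≤ 2D (A + log q + 2 log(1+|y|))/(1 + y²)`, the tree's left-line bound for `L'/L`, MV Lemma 12.9,
against `‖F₀(z)‖ ≤ D/‖z‖²`). [cite: MontgomeryVaughan2007, Lemma 12.9] -/
private theorem continuousAt_charEFRemainder_half (hprim : χ.IsPrimitive) (hq : 1 < q)
    (h : IsSmoothedEFTest f p p' p'' x₀) :
    ContinuousAt (fun s : ℂ ↦ charEFRemainder χ f s) (1 / 2) := by
  obtain ⟨A, hA0, hA⟩ := exists_norm_logDeriv_LFunction_leftLine_le
  set D := SmoothedEF.decayConst p' p'' x₀ with hD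
  have hD0 : 0 ≤ D := SmoothedEF.decayConst_nonneg h.x₀_nonneg
  have hq0 : 0 ≤ Real.log q := Real.log_natCast_nonneg q
  have hball : ∀ s : ℂ, s ∈ Metric.ball (1 / 2 : ℂ) 1 → -(1 / 2) < s.re ∧ |s.im| < 1 := by
    intro s hs
    rw [Metric.mem_ball, dist_eq_norm] at hs
    have h1 := Complex.abs_re_le_norm (s - 1 / 2)
    have h2 := Complex.abs_im_le_norm (s - 1 / 2)
    have hre : (s - 1 / 2).re = s.re - 1 / 2 := by simp
    have him : (s - 1 / 2).im = s.im := by simp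
    rw [hre] at h1
    rw [him] at h2
    constructor
    · have := (abs_lt.1 (lt_of_le_of_lt h1 hs)).1; linarith
    · exact lt_of_le_of_lt h2 hs
  have hI : ContinuousAt (fun s : ℂ ↦ ∫ y : ℝ, charEFIntegrand χ f s (((-(5 / 2) : ℝ) : ℂ) + y * I)) (1 / 2) := by
    refine continuousAt_of_dominated (μ := volume)
      (bound := fun y : ℝ ↦ 2 * D * ((A + Real.log q + 2 * Real.log (1 + |y|)) / (1 ^ 2 + (0 - y) ^ 2)))
      ?_ ?_ ?_ ?_
    · filter_upwards [Metric.ball_mem_nhds (1 / 2 : ℂ) one_pos] with s hs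
      exact (continuous_charIntegrand_left hprim hq h (by linarith [(hball s hs).1])).aestronglyMeasurable
    · filter_upwards [Metric.ball_mem_nhds (1 / 2 : ℂ) one_pos] with s hs
      obtain ⟨hsre, hsim⟩ := hball s hs
      refine ae_of_all _ fun y ↦ ?_
      set w : ℂ := ((-(5 / 2) : ℝ) : ℂ) + y * I with hw
      have hsw_re : (s - w).re = s.re + 5 / 2 := by simp [hw]
      have hsw_im : (s - w).im = s.im - y := by simp [hw]
      have hsw : s - w ≠ 0 := fun h0 ↦ by
        have := congrArg Complex.re h0
        rw [hsw_re, Complex.zero_re] at this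
        linarith
      have hnorm : ‖s - w‖ ^ 2 = (s.re + 5 / 2) ^ 2 + (s.im - y) ^ 2 := by
        rw [Complex.sq_norm, Complex.normSq_apply, hsw_re, hsw_im]; ring
      have him1 : |s.im| < 1 := hsim
      have hlowsq : (1 ^ 2 + (0 - y) ^ 2) / 2 ≤ ‖s - w‖ ^ 2 := by
        rw [hnorm]
        have h1 : (2 : ℝ) ^ 2 ≤ (s.re + 5 / 2) ^ 2 := by
          have : (2 : ℝ) ≤ s.re + 5 / 2 := by linarith
          nlinarith
        have h2 : s.im ^ 2 ≤ 1 := by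
          have := abs_lt.1 him1
          nlinarith
        nlinarith [sq_nonneg (2 * s.im - y)]
      have hF : ‖fordLaplace₀ f (s - w)‖ ≤ 2 * D / (1 ^ 2 + (0 - y) ^ 2) := by
        refine (SmoothedEF.norm_fordLaplace₀_le h hsw (by rw [hsw_re]; linarith)).trans ?_
        rw [← hD]
        have hpos : 0 < (1 ^ 2 + (0 - y) ^ 2) / 2 := by positivity
        calc D / ‖s - w‖ ^ 2 ≤ D / ((1 ^ 2 + (0 - y) ^ 2) / 2) := div_le_div_of_nonneg_left hD0 hpos hlowsq
          _ = 2 * D / (1 ^ 2 + (0 - y) ^ 2) := by field_simp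
      rw [charEFIntegrand, norm_mul, norm_neg]
      obtain ⟨-, hb⟩ := hA q χ hprim hq y
      have hC1 : 0 ≤ A + Real.log q + 2 * Real.log (1 + |y|) :=
        add_nonneg (by positivity) (mul_nonneg two_pos.le (Real.log_nonneg (by linarith [abs_nonneg y])))
      calc ‖deriv χ.LFunction w / χ.LFunction w‖ * ‖fordLaplace₀ f (s - w)‖
          ≤ (A + Real.log q + 2 * Real.log (1 + |y|)) * (2 * D / (1 ^ 2 + (0 - y) ^ 2)) :=
            mul_le_mul hb hF (norm_nonneg _) hC1
        _ = 2 * D * ((A + Real.log q + 2 * Real.log (1 + |y|)) / (1 ^ 2 + (0 - y) ^ 2)) := by ring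
    · exact (SmoothedEF.integrable_left_majorant' (A := A + Real.log q) (by positivity) one_pos
        (t := 0)).const_mul (2 * D)
    · refine ae_of_all _ fun y ↦ ?_
      set w : ℂ := ((-(5 / 2) : ℝ) : ℂ) + y * I with hw
      have hz : (1 / 2 : ℂ) - w ≠ 0 := fun h0 ↦ by
        have := congrArg Complex.re h0
        simp [hw] at this
        norm_num at this
      have hlin : ContinuousAt (fun s : ℂ ↦ s - w) (1 / 2) := by fun_prop
      have hF : ContinuousAt (fun s : ℂ ↦ fordLaplace₀ f (s - w)) (1 / 2) :=
        (continuousAt_fordLaplace₀ h hz).comp_of_eq hlin rfl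
      show ContinuousAt (fun s : ℂ ↦ charEFIntegrand χ f s w) (1 / 2)
      unfold charEFIntegrand
      exact continuousAt_const.mul hF
  unfold charEFRemainder
  exact hI.const_mul _

/-- **The zero sum at `s = ½` converges absolutely for every primitive `χ` mod `q > 1`** (also when `L(½, χ) = 0`:
the zeros `ρ ≠ ½` stay at distance `≥ d` from `½`, `‖F₀(½ − ρ)‖ ≤ 4D/‖½ − ρ‖²`). [cite: HeathBrown1992PLMS, Lemma 5.1] -/
theorem summable_zeroTerm_half (hprim : χ.IsPrimitive) (hq : 1 < q) (h : IsSmoothedEFTest f p p' p'' x₀) :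
    Summable fun ρ : charNontrivialZeros χ ↦
      (DirichletDisc.zeroOrder χ (ρ : ℂ) : ℂ) * fordLaplace₀ f (1 / 2 - ρ) := by
  classical
  have hχ := ne_one_of_isPrimitive hprim hq
  by_cases hzero : χ.LFunction (1 / 2) = 0
  swap
  · exact (summable_norm_charZeroTerm hprim hq h (s := 1 / 2) (by norm_num) hzero).of_norm
  obtain ⟨ρ₀, hρ₀v⟩ : ∃ ρ₀ : charNontrivialZeros χ, (ρ₀ : ℂ) = 1 / 2 :=
    ⟨⟨1 / 2, hzero, by norm_num, by norm_num⟩, rfl⟩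
  obtain ⟨d, hd0, hd1, hd⟩ := exists_dist_charZeros_ge' hχ (1 / 2 : ℂ)
  set D := SmoothedEF.decayConst p' p'' x₀ with hD
  have hD0 : 0 ≤ D := SmoothedEF.decayConst_nonneg h.x₀_nonneg
  have hite : Summable fun ρ : charNontrivialZeros χ ↦
      if ρ = ρ₀ then (0 : ℂ) else (DirichletDisc.zeroOrder χ (ρ : ℂ) : ℂ) * fordLaplace₀ f (1 / 2 - ρ) := by
    refine Summable.of_norm_bounded ((summable_zeroOrder_div_norm_sq' hprim hq).mul_left (4 * D)) fun ρ ↦ ?_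
    by_cases hρ : ρ = ρ₀
    · simp only [hρ, if_true, norm_zero]
      exact mul_nonneg (mul_nonneg (by norm_num) hD0) (by positivity)
    · simp only [hρ, if_false]
      have hne : (ρ : ℂ) ≠ 1 / 2 := fun h' ↦ hρ (Subtype.ext (h'.trans hρ₀v.symm))
      have hb := (norm_zeroTerm_le (χ := χ) h hd0 hd1 ρ.2 (hd _ ρ.2 hne) (δ := 0)
        (by rw [abs_zero]; linarith)).2
      rw [Complex.ofReal_zero, add_zero] at hb
      have hm0 : (0 : ℝ) ≤ DirichletDisc.zeroOrder χ (ρ : ℂ) := Nat.cast_nonneg _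
      rw [norm_mul, Complex.norm_natCast]
      calc (DirichletDisc.zeroOrder χ (ρ : ℂ) : ℝ) * ‖fordLaplace₀ f (1 / 2 - ρ)‖
          ≤ (DirichletDisc.zeroOrder χ (ρ : ℂ) : ℝ) * (4 * D / ‖(1 / 2 : ℂ) - ρ‖ ^ 2) :=
            mul_le_mul_of_nonneg_left hb hm0
        _ = 4 * D * ((DirichletDisc.zeroOrder χ (ρ : ℂ) : ℝ) / ‖(1 / 2 : ℂ) - ρ‖ ^ 2) := by ring
  refine (hite.add (hasSum_ite_eq ρ₀
    ((DirichletDisc.zeroOrder χ (ρ₀ : ℂ) : ℂ) * fordLaplace₀ f (1 / 2 - ρ₀))).summable).congr fun ρ ↦ ?_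
  by_cases hρ : ρ = ρ₀
  · subst hρ; simp
  · simp [hρ]

/-- **The exact smoothed explicit formula at `s = ½` when `L(½, χ) = 0`** (order `m ≥ 1`; Heath-Brown's Lemma 5.1
in the form needed for Suzuki's (4.4')–(4.5')): for a primitive `χ` mod `q > 1` with `L(½, χ) = 0` there is
`c₀ = lim_{s→½}[(L'/L)(s, χ) − m/(s − ½)]` such that for EVERY admissible smoothing `f`,
`K_{f,χ}(½) = −f(0)c₀ − Σ'_ρ m(ρ)F₀(½ − ρ) − Σ_τ m(τ)F₀(½ − τ) + J_χ(f, ½)`, where the term of the zero `ρ = ½`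
reads `m·F₀(0) = m·F(0)` (`F` the full Laplace transform; in Lean `f(0)/0 = 0`). Obtained from the tree's
`charFordK_eq_explicit` at `s = ½ + δ` as `δ → 0⁺`: `−f(0)(L'/L)(½+δ) − mF₀(δ) = −f(0)[(L'/L)(½+δ) − m/δ] − mF(δ)`,
and every other term is continuous in `s`. [cite: Suzuki2025Chebyshev, §4.1 (4.4')–(4.5')]
[cite: HeathBrown1992PLMS, Lemma 5.1] -/
theorem charFordK_half_eq_explicit_of_zero (hprim : χ.IsPrimitive) (hq : 1 < q)
    (hzero : χ.LFunction (1 / 2) = 0) :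
    ∃ c₀ : ℂ, Tendsto (fun s ↦ logDeriv χ.LFunction s - (DirichletDisc.zeroOrder χ (1 / 2) : ℂ) / (s - 1 / 2))
        (𝓝[≠] (1 / 2)) (𝓝 c₀) ∧
      ∀ (f p p' p'' : ℝ → ℝ) (x₀ : ℝ), IsSmoothedEFTest f p p' p'' x₀ →
        charFordK χ f (1 / 2) = -(f 0 : ℂ) * c₀
          - ∑' ρ : charNontrivialZeros χ, (DirichletDisc.zeroOrder χ (ρ : ℂ) : ℂ) * fordLaplace₀ f (1 / 2 - ρ)
          - ∑ τ ∈ charTrivialZeroFinset (ne_one_of_isPrimitive hprim hq),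
              (DirichletDisc.zeroOrder χ τ : ℂ) * fordLaplace₀ f (1 / 2 - τ)
          + charEFRemainder χ f (1 / 2) := by
  classical
  have hχ := ne_one_of_isPrimitive hprim hq
  obtain ⟨c₀, hc₀⟩ := exists_tendsto_logDeriv_sub_polar (χ := χ) hχ
  refine ⟨c₀, hc₀, fun f p p' p'' x₀ h ↦ ?_⟩
  set m : ℕ := DirichletDisc.zeroOrder χ (1 / 2) with hm
  obtain ⟨ρ₀, hρ₀v⟩ : ∃ ρ₀ : charNontrivialZeros χ, (ρ₀ : ℂ) = 1 / 2 :=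
    ⟨⟨1 / 2, hzero, by norm_num, by norm_num⟩, rfl⟩
  obtain ⟨d, hd0, hd1, hd⟩ := exists_dist_charZeros_ge' hχ (1 / 2 : ℂ)
  set D := SmoothedEF.decayConst p' p'' x₀ with hD
  set Zp : ℝ → ℂ := fun δ ↦ ∑' ρ : charNontrivialZeros χ,
    if ρ = ρ₀ then (0 : ℂ) else (DirichletDisc.zeroOrder χ (ρ : ℂ) : ℂ) * fordLaplace₀ f (1 / 2 + δ - ρ)
    with hZp
  set Tp : ℝ → ℂ := fun δ ↦ ∑ τ ∈ charTrivialZeroFinset hχ,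
    (DirichletDisc.zeroOrder χ τ : ℂ) * fordLaplace₀ f (1 / 2 + δ - τ) with hTp
  set Φ : ℝ → ℂ := fun δ ↦
    -(f 0 : ℂ) * (logDeriv χ.LFunction (1 / 2 + δ) - (m : ℂ) / ((1 / 2 + δ : ℂ) - 1 / 2))
      - (m : ℂ) * fordLaplace f δ - Zp δ - Tp δ + charEFRemainder χ f (1 / 2 + δ) with hΦ
  -- (1) for small `δ > 0` the tree's formula at `s = ½ + δ` is `Φ δ`
  have hformula : ∀ᶠ δ : ℝ in 𝓝[>] 0, charFordK χ f (1 / 2 + δ) = Φ δ := by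
    have hmem : Ioo (0 : ℝ) (min d (1 / 2)) ∈ 𝓝[>] (0 : ℝ) := Ioo_mem_nhdsGT (lt_min hd0 one_half_pos)
    filter_upwards [hmem] with δ hδ
    obtain ⟨hδ0, hδ1⟩ := hδ
    have hδd : δ < d := hδ1.trans_le (min_le_left _ _)
    have hδh : δ < 1 / 2 := hδ1.trans_le (min_le_right _ _)
    have hsre : ((1 / 2 : ℂ) + δ).re = 1 / 2 + δ := by simp
    have hLs : χ.LFunction (1 / 2 + δ) ≠ 0 := by
      intro h0
      have hmemZ : ((1 / 2 : ℂ) + δ) ∈ charNontrivialZeros χ :=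
        ⟨h0, by rw [hsre]; linarith, by rw [hsre]; linarith⟩
      have hne : ((1 / 2 : ℂ) + δ) ≠ 1 / 2 := by
        intro he
        have := congrArg Complex.re he
        rw [hsre] at this
        norm_num at this
        linarith
      have h1 := hd _ hmemZ hne
      have hnorm : ‖(1 / 2 : ℂ) - (1 / 2 + δ)‖ = δ := by
        rw [show (1 / 2 : ℂ) - (1 / 2 + δ) = -(δ : ℂ) by ring, norm_neg, Complex.norm_real,
          Real.norm_of_nonneg hδ0.le]
      linarith
    have htree := charFordK_eq_explicit hprim hq h (s := 1 / 2 + δ) (by rw [hsre]; linarith)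
      (by rw [hsre]; linarith) hLs
    have hsum := (summable_norm_charZeroTerm hprim hq h (s := 1 / 2 + δ) (by rw [hsre]; linarith) hLs).of_norm
    have hsplit := hsum.tsum_eq_add_tsum_ite ρ₀
    rw [htree, hsplit, hρ₀v]
    simp only [hΦ, hZp, hTp, logDeriv_apply]
    rw [show (1 / 2 : ℂ) + δ - 1 / 2 = δ by ring, fordLaplace₀]
    ring
  -- (2) limits as `δ → 0⁺`
  have hcast : Tendsto (fun δ : ℝ ↦ (1 / 2 : ℂ) + δ) (𝓝[>] 0) (𝓝 (1 / 2)) := by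
    have h1 : Tendsto (fun δ : ℝ ↦ (1 / 2 : ℂ) + δ) (𝓝 0) (𝓝 ((1 / 2 : ℂ) + ((0 : ℝ) : ℂ))) :=
      (Complex.continuous_ofReal.tendsto 0).const_add _
    rw [Complex.ofReal_zero, add_zero] at h1
    exact h1.mono_left nhdsWithin_le_nhds
  have hcast' : Tendsto (fun δ : ℝ ↦ (1 / 2 : ℂ) + δ) (𝓝[>] 0) (𝓝[≠] (1 / 2)) := by
    refine tendsto_nhdsWithin_iff.2 ⟨hcast, ?_⟩
    filter_upwards [self_mem_nhdsWithin] with δ hδ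
    intro he
    have := congrArg Complex.re he
    simp at this
    exact (ne_of_gt hδ) this
  have hLHS : Tendsto (fun δ : ℝ ↦ charFordK χ f (1 / 2 + δ)) (𝓝[>] 0) (𝓝 (charFordK χ f (1 / 2))) :=
    ((continuous_charFordK χ h).tendsto _).comp hcast
  have h1 : Tendsto (fun δ : ℝ ↦ logDeriv χ.LFunction (1 / 2 + δ) - (m : ℂ) / ((1 / 2 + δ : ℂ) - 1 / 2))
      (𝓝[>] 0) (𝓝 c₀) := hc₀.comp hcast'
  have h2 : Tendsto (fun δ : ℝ ↦ fordLaplace f δ) (𝓝[>] 0) (𝓝 (fordLaplace f 0)) := by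
    have h2' := ((differentiable_fordLaplace h.cont h.x₀_nonneg h.eq_zero).continuous.tendsto (0 : ℂ)).comp
      (Complex.continuous_ofReal.tendsto (0 : ℝ))
    exact h2'.mono_left nhdsWithin_le_nhds
  have h3 : Tendsto Zp (𝓝[>] 0) (𝓝 (Zp 0)) := by
    have hco := continuousOn_zeroSum_punctured hprim hq h ρ₀ hρ₀v hd0 hd1 hd
    have hca : ContinuousAt Zp 0 := hco.continuousAt (Icc_mem_nhds (by linarith) (by linarith))
    exact hca.tendsto.mono_left nhdsWithin_le_nhds
  have h4 : Tendsto Tp (𝓝[>] 0) (𝓝 (Tp 0)) := by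
    have hca : ContinuousAt Tp 0 := by
      have hterm : ∀ τ ∈ charTrivialZeroFinset hχ, ContinuousAt
          (fun δ : ℝ ↦ (DirichletDisc.zeroOrder χ τ : ℂ) * fordLaplace₀ f (1 / 2 + δ - τ)) 0 := by
        intro τ hτ
        have hz : (1 / 2 : ℂ) + ((0 : ℝ) : ℂ) - τ ≠ 0 := by
          rw [Complex.ofReal_zero, add_zero]; exact half_sub_triv_ne_zero hτ
        have hlin : ContinuousAt (fun δ : ℝ ↦ (1 / 2 : ℂ) + δ - τ) 0 := by fun_prop
        exact continuousAt_const.mul ((continuousAt_fordLaplace₀ h hz).comp_of_eq hlin rfl)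
      have := tendsto_finsetSum (charTrivialZeroFinset hχ) (fun τ hτ ↦ (hterm τ hτ).tendsto)
      exact this
    exact hca.tendsto.mono_left nhdsWithin_le_nhds
  have h5 : Tendsto (fun δ : ℝ ↦ charEFRemainder χ f (1 / 2 + δ)) (𝓝[>] 0)
      (𝓝 (charEFRemainder χ f (1 / 2))) :=
    (continuousAt_charEFRemainder_half hprim hq h).tendsto.comp hcast
  have hΦlim : Tendsto Φ (𝓝[>] 0)
      (𝓝 (-(f 0 : ℂ) * c₀ - (m : ℂ) * fordLaplace f 0 - Zp 0 - Tp 0 + charEFRemainder χ f (1 / 2))) :=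
    ((((h1.const_mul _).sub (h2.const_mul _)).sub h3).sub h4).add h5
  have hlim_eq := tendsto_nhds_unique_of_eventuallyEq hLHS hΦlim hformula
  -- (3) the full zero sum at `½` is `m·F(0) + (punctured sum)`
  have hfull := summable_zeroTerm_half hprim hq h
  have hZ0 : Zp 0 = ∑' ρ : charNontrivialZeros χ,
      if ρ = ρ₀ then (0 : ℂ) else (DirichletDisc.zeroOrder χ (ρ : ℂ) : ℂ) * fordLaplace₀ f (1 / 2 - ρ) := by
    simp only [hZp, Complex.ofReal_zero, add_zero]
  have hT0 : Tp 0 = ∑ τ ∈ charTrivialZeroFinset hχ,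
      (DirichletDisc.zeroOrder χ τ : ℂ) * fordLaplace₀ f (1 / 2 - τ) := by
    simp only [hTp, Complex.ofReal_zero, add_zero]
  have hF00 : fordLaplace₀ f (1 / 2 - ρ₀) = fordLaplace f 0 := by
    rw [hρ₀v, sub_self, fordLaplace₀, div_zero, sub_zero]
  rw [hlim_eq, hfull.tsum_eq_add_tsum_ite ρ₀, hF00, hρ₀v, hZ0, hT0]
  ring

/-! ### §8.2 The weight `h_L`: `F(0) = L³/6`, the order-`m` formula for `F₂(L)` and for `f_χ(x)` ((4.5')) -/

/-- `F(0) = ∫₀^L (L − u)²/2 du = L³/6` for the quadratic weight `h_L` (`L ≥ 0`). [folklore] -/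
private theorem fordLaplace_quadWeight_zero {L : ℝ} (hL : 0 ≤ L) :
    fordLaplace (quadWeight L) 0 = ((L ^ 3 / 6 : ℝ) : ℂ) := by
  have h := isSmoothedEFTest_quadWeight hL
  have hpc : Continuous fun u : ℝ ↦ (L - u) ^ 2 / 2 := by fun_prop
  rw [fordLaplace_eq_intervalIntegral h.x₀_nonneg h.eqOn h.eq_zero hpc 0]
  simp only [zero_mul, neg_zero, Complex.exp_zero, mul_one]
  rw [intervalIntegral.integral_ofReal]
  congr 1
  have hderiv : ∀ x ∈ uIcc 0 L, HasDerivAt (fun u : ℝ ↦ -(L - u) ^ 3 / 6) ((L - x) ^ 2 / 2) x := by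
    intro x _
    have h1 := (((hasDerivAt_id x).const_sub L).pow 3).neg.div_const 6
    refine h1.congr_deriv ?_
    simp only [id_eq, Nat.cast_ofNat]
    ring
  rw [intervalIntegral.integral_eq_sub_of_hasDerivAt hderiv (hpc.intervalIntegrable _ _)]
  ring

/-- `H₀(0; L) = 0` and `∂_L H₀(0; L) = 0` in Lean (division by zero). [folklore] -/
private theorem quadLaplace₀_zero_left (L : ℝ) : quadLaplace₀ 0 L = 0 ∧ quadLaplace₀Deriv 0 L = 0 := by
  simp [quadLaplace₀, quadLaplace₀Deriv]

/-- **The exact formula for `F₂(L)` with a zero at `½`** (`L ≥ 0`, primitive `χ` mod `q > 1`, `L(½, χ) = 0` of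
order `m`): `F₂(L) = −(L²/2)c₀ − mL³/6 − Z(L) − T(L) + J(L)` (the zero `ρ = ½` contributes `m·F(0) = mL³/6`; in
`Z(L)` its term is `m·H₀(0; L) = 0`). [cite: Suzuki2025Chebyshev, §4.1 (4.4')–(4.5')] -/
theorem rieszTwo_eq_explicit_of_zero (hprim : χ.IsPrimitive) (hq : 1 < q) (hzero : χ.LFunction (1 / 2) = 0) :
    ∃ c₀ : ℂ, Tendsto (fun s ↦ logDeriv χ.LFunction s - (DirichletDisc.zeroOrder χ (1 / 2) : ℂ) / (s - 1 / 2))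
        (𝓝[≠] (1 / 2)) (𝓝 c₀) ∧
      ∀ L : ℝ, 0 ≤ L →
        rieszTwo χ L = -((L ^ 2 / 2 : ℝ) : ℂ) * c₀
          - (DirichletDisc.zeroOrder χ (1 / 2) : ℂ) * ((L ^ 3 / 6 : ℝ) : ℂ)
          - zeroSide χ L - trivSide (ne_one_of_isPrimitive hprim hq) L + remSide χ L := by
  classical
  have hχ := ne_one_of_isPrimitive hprim hq
  obtain ⟨c₀, hc₀, hformula⟩ := charFordK_half_eq_explicit_of_zero hprim hq hzero
  refine ⟨c₀, hc₀, fun L hL ↦ ?_⟩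
  have h := isSmoothedEFTest_quadWeight hL
  have hK := hformula _ _ _ _ _ h
  obtain ⟨ρ₀, hρ₀v⟩ : ∃ ρ₀ : charNontrivialZeros χ, (ρ₀ : ℂ) = 1 / 2 :=
    ⟨⟨1 / 2, hzero, by norm_num, by norm_num⟩, rfl⟩
  have hfull := summable_zeroTerm_half hprim hq h
  -- the zero sum: `Σ' m F₀(½ − ρ) = m L³/6 + Z(L)`
  have hupd : (fun ρ : charNontrivialZeros χ ↦
      (DirichletDisc.zeroOrder χ (ρ : ℂ) : ℂ) * quadLaplace₀ (1 / 2 - ρ) L) =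
      Function.update (fun ρ : charNontrivialZeros χ ↦
        (DirichletDisc.zeroOrder χ (ρ : ℂ) : ℂ) * fordLaplace₀ (quadWeight L) (1 / 2 - ρ)) ρ₀ 0 := by
    funext ρ
    by_cases hρ : ρ = ρ₀
    · subst hρ
      rw [Function.update_self, hρ₀v, sub_self, (quadLaplace₀_zero_left L).1, mul_zero]
    · have hne : (1 / 2 : ℂ) - ρ ≠ 0 := by
        intro h0
        exact hρ (Subtype.ext ((sub_eq_zero.1 h0).symm.trans hρ₀v.symm))
      rw [Function.update_of_ne hρ, fordLaplace₀_quadWeight hL hne]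
  have hZ : ∑' ρ : charNontrivialZeros χ,
      (DirichletDisc.zeroOrder χ (ρ : ℂ) : ℂ) * fordLaplace₀ (quadWeight L) (1 / 2 - ρ) =
      (DirichletDisc.zeroOrder χ (1 / 2) : ℂ) * ((L ^ 3 / 6 : ℝ) : ℂ) + zeroSide χ L := by
    have hu := (hfull.hasSum.update ρ₀ 0).tsum_eq
    rw [← hupd] at hu
    rw [zeroSide, hu, hρ₀v, sub_self, fordLaplace₀, div_zero, sub_zero, fordLaplace_quadWeight_zero hL]
    ring
  have hT : ∑ τ ∈ charTrivialZeroFinset hχ,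
      (DirichletDisc.zeroOrder χ τ : ℂ) * fordLaplace₀ (quadWeight L) (1 / 2 - τ) = trivSide hχ L := by
    rw [trivSide]
    refine Finset.sum_congr rfl fun τ hτ ↦ ?_
    rw [fordLaplace₀_quadWeight hL (half_sub_triv_ne_zero hτ)]
  rw [rieszTwo, hK, quadWeight_zero hL, hZ, hT, charEFRemainder_quadWeight hL]
  push_cast
  ring

/-- **Termwise differentiation of the zero side without `L(½, χ) ≠ 0`** (the term of a zero at `½` is identically
`0`). [folklore] -/
private theorem hasDerivAt_zeroSide' (hprim : χ.IsPrimitive) (hq : 1 < q)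
    (L : ℝ) : HasDerivAt (zeroSide χ) (zeroSideDeriv χ L) L := by
  set M : ℝ := |L| + 1 with hM
  have hM0 : 0 < M := by positivity
  set u : charNontrivialZeros χ → ℝ := fun ρ ↦
    (1 + rexp (M / 2)) * ((DirichletDisc.zeroOrder χ (ρ : ℂ) : ℝ) / ‖(1 / 2 : ℂ) - ρ‖ ^ 2) with hu
  have hsu : Summable u := (summable_zeroOrder_div_norm_sq' hprim hq).mul_left _
  have h := hasDerivAt_tsum_of_isPreconnected (t := Set.Ioo (-M) M) (y₀ := 0)
    (g := fun (ρ : charNontrivialZeros χ) (L' : ℝ) ↦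
      (DirichletDisc.zeroOrder χ (ρ : ℂ) : ℂ) * quadLaplace₀ (1 / 2 - ρ) L')
    (g' := fun (ρ : charNontrivialZeros χ) (L' : ℝ) ↦
      (DirichletDisc.zeroOrder χ (ρ : ℂ) : ℂ) * quadLaplace₀Deriv (1 / 2 - ρ) L')
    hsu isOpen_Ioo isPreconnected_Ioo ?_ ?_ (by simp [hM0]) (by simp [summable_zero]) (y := L)
    (by rw [Set.mem_Ioo, hM]; constructor <;> linarith [neg_abs_le L, le_abs_self L])
  · exact h
  · intro ρ y _
    by_cases hz : (1 / 2 : ℂ) - ρ = 0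
    · rw [hz]
      have h0 : ∀ L', quadLaplace₀ 0 L' = 0 := fun L' ↦ (quadLaplace₀_zero_left L').1
      have h0' : quadLaplace₀Deriv 0 y = 0 := (quadLaplace₀_zero_left y).2
      simp only [h0, h0', mul_zero]
      exact hasDerivAt_const y (0 : ℂ)
    · exact (hasDerivAt_quadLaplace₀ hz y).const_mul _
  · intro ρ y hy
    rw [Set.mem_Ioo] at hy
    rw [norm_mul, Complex.norm_natCast, hu]
    have hm : (0 : ℝ) ≤ DirichletDisc.zeroOrder χ (ρ : ℂ) := Nat.cast_nonneg _
    by_cases hz : (1 / 2 : ℂ) - ρ = 0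
    · rw [hz, (quadLaplace₀_zero_left y).2, norm_zero, mul_zero]
      positivity
    have hb := norm_quadLaplace₀Deriv_le ((1 / 2 : ℂ) - ρ) y
    have hre := abs_re_half_sub_le ρ
    have hexp : rexp (-(((1 / 2 : ℂ) - ρ).re * y)) ≤ rexp (M / 2) := by
      rw [Real.exp_le_exp]
      have hy' : |y| ≤ M := (abs_lt.2 ⟨hy.1, hy.2⟩).le
      have h1 : -(((1 / 2 : ℂ) - ρ).re * y) ≤ |((1 / 2 : ℂ) - ρ).re| * |y| := by
        rw [← abs_mul]; exact neg_le_abs _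
      nlinarith [abs_nonneg y, abs_nonneg (((1 / 2 : ℂ) - ρ).re)]
    have hpos : 0 < ‖(1 / 2 : ℂ) - ρ‖ ^ 2 := by
      have := norm_pos_iff.2 hz
      positivity
    calc (DirichletDisc.zeroOrder χ (ρ : ℂ) : ℝ) * ‖quadLaplace₀Deriv (1 / 2 - ρ) y‖
        ≤ (DirichletDisc.zeroOrder χ (ρ : ℂ) : ℝ) * ((1 + rexp (M / 2)) / ‖(1 / 2 : ℂ) - ρ‖ ^ 2) := by
          refine mul_le_mul_of_nonneg_left (hb.trans ?_) hm
          gcongr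
      _ = (1 + rexp (M / 2)) * ((DirichletDisc.zeroOrder χ (ρ : ℂ) : ℝ) / ‖(1 / 2 : ℂ) - ρ‖ ^ 2) := by
          ring

/-- **The zero side under GRH, without `L(½, χ) ≠ 0`**: `‖Z'(L)‖ ≤ Σ_ρ 2m(ρ)/‖½ − ρ‖²`.
[cite: Suzuki2025Chebyshev, §4.1 (proof of Thm 8: «each term … is bounded»)] -/
theorem norm_zeroSideDeriv_le_of_GRH' (hprim : χ.IsPrimitive) (hq : 1 < q)
    (hGRH : χ.RiemannHypothesis) (L : ℝ) :
    ‖zeroSideDeriv χ L‖ ≤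
      ∑' ρ : charNontrivialZeros χ, 2 * ((DirichletDisc.zeroOrder χ (ρ : ℂ) : ℝ) / ‖(1 / 2 : ℂ) - ρ‖ ^ 2) := by
  refine tsum_of_norm_bounded ((summable_zeroOrder_div_norm_sq' hprim hq).mul_left 2).hasSum
    fun ρ ↦ ?_
  have hre : ((1 / 2 : ℂ) - (ρ : ℂ)).re = 0 := by
    have := hGRH ρ ρ.2.1 ρ.2.2.1 ρ.2.2.2
    simp [this]
  have hm : (0 : ℝ) ≤ DirichletDisc.zeroOrder χ (ρ : ℂ) := Nat.cast_nonneg _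
  rw [norm_mul, Complex.norm_natCast]
  have hb := norm_quadLaplace₀Deriv_le ((1 / 2 : ℂ) - ρ) L
  rw [hre, zero_mul, neg_zero, Real.exp_zero] at hb
  calc (DirichletDisc.zeroOrder χ (ρ : ℂ) : ℝ) * ‖quadLaplace₀Deriv (1 / 2 - ρ) L‖
      ≤ (DirichletDisc.zeroOrder χ (ρ : ℂ) : ℝ) * ((1 + 1) / ‖(1 / 2 : ℂ) - ρ‖ ^ 2) :=
        mul_le_mul_of_nonneg_left hb hm
    _ = 2 * ((DirichletDisc.zeroOrder χ (ρ : ℂ) : ℝ) / ‖(1 / 2 : ℂ) - ρ‖ ^ 2) := by ring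

/-- **Suzuki's (4.5') as an exact formula, RH-FREE** (primitive `χ` mod `q > 1`, `L(½, χ) = 0` of order `m`,
`x > 1`): `f_χ(x) = −c₀ log x − (m/2) log²x − Z'(log x) − T'(log x) + J'(log x)` with
`c₀ = lim_{s→½}[(L'/L)(s, χ) − m/(s − ½)]` (the `L`-derivative of `rieszTwo_eq_explicit_of_zero`).
[cite: Suzuki2025Chebyshev, §4.1 (4.5')] -/
theorem halfLineSum_eq_explicit_of_zero (hprim : χ.IsPrimitive) (hq : 1 < q)
    (hzero : χ.LFunction (1 / 2) = 0) :
    ∃ c₀ : ℂ, Tendsto (fun s ↦ logDeriv χ.LFunction s - (DirichletDisc.zeroOrder χ (1 / 2) : ℂ) / (s - 1 / 2))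
        (𝓝[≠] (1 / 2)) (𝓝 c₀) ∧
      ∀ x : ℝ, 1 < x →
        halfLineSum χ x = -(Real.log x : ℂ) * c₀
          - (DirichletDisc.zeroOrder χ (1 / 2) : ℂ) * (((Real.log x) ^ 2 / 2 : ℝ) : ℂ)
          - zeroSideDeriv χ (Real.log x) - trivSideDeriv (ne_one_of_isPrimitive hprim hq) (Real.log x)
          + remSideDeriv χ (Real.log x) := by
  set hχ := ne_one_of_isPrimitive hprim hq
  obtain ⟨c₀, hc₀, hR⟩ := rieszTwo_eq_explicit_of_zero hprim hq hzero
  refine ⟨c₀, hc₀, fun x hx ↦ ?_⟩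
  set m : ℂ := (DirichletDisc.zeroOrder χ (1 / 2) : ℂ) with hm
  set L₀ : ℝ := Real.log x with hL₀
  have hL₀pos : 0 < L₀ := Real.log_pos hx
  set R : ℝ → ℂ := fun L ↦ -((L ^ 2 / 2 : ℝ) : ℂ) * c₀ - m * ((L ^ 3 / 6 : ℝ) : ℂ)
    - zeroSide χ L - trivSide hχ L + remSide χ L with hRdef
  have hsq : HasDerivAt (fun L : ℝ ↦ ((L ^ 2 / 2 : ℝ) : ℂ)) (L₀ : ℂ) L₀ := by
    have h := (((hasDerivAt_id L₀).pow 2).div_const 2).ofReal_comp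
    refine h.congr_deriv ?_
    simp
  have hcube : HasDerivAt (fun L : ℝ ↦ ((L ^ 3 / 6 : ℝ) : ℂ)) (((L₀ ^ 2 / 2 : ℝ) : ℂ)) L₀ := by
    have h := (((hasDerivAt_id L₀).pow 3).div_const 6).ofReal_comp
    refine h.congr_deriv ?_
    simp only [id_eq, Nat.cast_ofNat]
    push_cast
    ring
  have hRd : HasDerivAt R (-(L₀ : ℂ) * c₀ - m * (((L₀ ^ 2 / 2 : ℝ) : ℂ)) - zeroSideDeriv χ L₀
      - trivSideDeriv hχ L₀ + remSideDeriv χ L₀) L₀ :=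
    ((((hsq.neg.mul_const c₀).sub (hcube.const_mul m)).sub (hasDerivAt_zeroSide' hprim hq L₀)).sub
      (hasDerivAt_trivSide hχ L₀)).add (hasDerivAt_remSide hprim hq hL₀pos.le)
  have hev : rieszTwo χ =ᶠ[𝓝 L₀] R := by
    filter_upwards [Ioi_mem_nhds hL₀pos] with L hL
    rw [hRdef]
    exact hR L (le_of_lt hL)
  have h1 : HasDerivAt (rieszTwo χ) (-(L₀ : ℂ) * c₀ - m * (((L₀ ^ 2 / 2 : ℝ) : ℂ)) - zeroSideDeriv χ L₀
      - trivSideDeriv hχ L₀ + remSideDeriv χ L₀) L₀ := hRd.congr_of_eventuallyEq hev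
  have h2 := hasDerivAt_rieszTwo χ L₀
  rw [hL₀, Real.exp_log (by linarith)] at h2
  exact h2.unique h1

/-- **(4.5') under GRH**: for a primitive `χ` mod `q > 1` with `L(½, χ) = 0` of order `m`, the GRH for `L(s, χ)`
gives `‖f_χ(x) + c₀ log x + (m/2) log²x‖ ≤ B` for `x > 1`. GRH-CONDITIONAL.
[cite: Suzuki2025Chebyshev, §4.1 Thm 8 (proof, (4.5'): «each term … is bounded except for the first and second terms»)] -/
theorem exists_norm_halfLineSum_add_le_of_GRH_of_zero (hprim : χ.IsPrimitive) (hq : 1 < q)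
    (hzero : χ.LFunction (1 / 2) = 0) (hGRH : χ.RiemannHypothesis) :
    ∃ c₀ : ℂ, ∃ B : ℝ, ∀ x : ℝ, 1 < x →
      ‖halfLineSum χ x + (Real.log x : ℂ) * c₀
        + (DirichletDisc.zeroOrder χ (1 / 2) : ℂ) * (((Real.log x) ^ 2 / 2 : ℝ) : ℂ)‖ ≤ B := by
  set hχ := ne_one_of_isPrimitive hprim hq
  obtain ⟨c₀, -, hF⟩ := halfLineSum_eq_explicit_of_zero hprim hq hzero
  obtain ⟨BJ, hBJ⟩ := exists_norm_remSideDeriv_le (χ := χ) hprim hq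
  set BZ : ℝ := ∑' ρ : charNontrivialZeros χ,
    2 * ((DirichletDisc.zeroOrder χ (ρ : ℂ) : ℝ) / ‖(1 / 2 : ℂ) - ρ‖ ^ 2)
  set BT : ℝ := ∑ τ ∈ charTrivialZeroFinset hχ, 2 * ((DirichletDisc.zeroOrder χ τ : ℝ) / ‖(1 / 2 : ℂ) - τ‖ ^ 2)
  refine ⟨c₀, BZ + BT + BJ, fun x hx ↦ ?_⟩
  have hL : 0 ≤ Real.log x := (Real.log_pos hx).le
  have heq : halfLineSum χ x + (Real.log x : ℂ) * c₀
      + (DirichletDisc.zeroOrder χ (1 / 2) : ℂ) * (((Real.log x) ^ 2 / 2 : ℝ) : ℂ) =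
      -zeroSideDeriv χ (Real.log x) - trivSideDeriv hχ (Real.log x) + remSideDeriv χ (Real.log x) := by
    rw [hF x hx]; ring
  rw [heq]
  have h1 := norm_zeroSideDeriv_le_of_GRH' hprim hq hGRH (Real.log x)
  have h2 := norm_trivSideDeriv_le hχ hL
  have h3 := hBJ _ hL
  calc ‖-zeroSideDeriv χ (Real.log x) - trivSideDeriv hχ (Real.log x) + remSideDeriv χ (Real.log x)‖
      ≤ ‖-zeroSideDeriv χ (Real.log x) - trivSideDeriv hχ (Real.log x)‖ + ‖remSideDeriv χ (Real.log x)‖ :=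
        norm_add_le _ _
    _ ≤ ‖-zeroSideDeriv χ (Real.log x)‖ + ‖trivSideDeriv hχ (Real.log x)‖ + ‖remSideDeriv χ (Real.log x)‖ := by
        gcongr; exact norm_sub_le _ _
    _ ≤ BZ + BT + BJ := by rw [norm_neg]; gcongr

/-- **Suzuki 2025, Thm 8, (4.2') ⟸ GRH, PROVED for primitive characters**: for a primitive `χ` mod `q > 1`
(`m` = the order of `L(s, χ)` at `½`, possibly `0`), the GRH for `L(s, χ)` implies
`(1/log x) Σ_{n ≤ x} Λ(n)χ(n) n^{-1/2}(1 − log n/log x) → −m/2` — the sum and limit exactly as typed in clause (c) of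
`Suzuki2025Chebyshev_thm8_limits` (`f_χ(x)/log²x → −m/2`: by (4.5) when `L(½, χ) ≠ 0`, `m = 0`; by (4.5')
otherwise). GRH-CONDITIONAL clause of a GRH-EQUIVALENT criterion. [cite: Suzuki2025Chebyshev, §4.1 Thm 8 ((4.2') ⟸ GRH)] -/
theorem tendsto_rieszMean_div_log_of_GRH (hprim : χ.IsPrimitive) (hq : 1 < q) (hGRH : χ.RiemannHypothesis) :
    Tendsto (fun x : ℝ ↦ (1 / (Real.log x : ℂ)) * ∑ n ∈ Finset.Icc 1 ⌊x⌋₊,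
        (Λ n : ℂ) * χ (n : ZMod q) / (Real.sqrt n : ℂ) * ((1 - Real.log n / Real.log x : ℝ) : ℂ))
      atTop (𝓝 (-((DirichletDisc.zeroOrder χ (1 / 2) : ℂ) / 2))) := by
  have hχ := ne_one_of_isPrimitive hprim hq
  set m : ℂ := (DirichletDisc.zeroOrder χ (1 / 2) : ℂ) with hm
  -- in both cases: `‖f_χ(x) + c₀ log x + (m/2) log² x‖ ≤ B` for `x > 1`
  obtain ⟨c₀, B, hB⟩ : ∃ c₀ : ℂ, ∃ B : ℝ, ∀ x : ℝ, 1 < x →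
      ‖halfLineSum χ x + (Real.log x : ℂ) * c₀ + m * (((Real.log x) ^ 2 / 2 : ℝ) : ℂ)‖ ≤ B := by
    by_cases hzero : χ.LFunction (1 / 2) = 0
    · exact exists_norm_halfLineSum_add_le_of_GRH_of_zero hprim hq hzero hGRH
    · have hm0 : m = 0 := by
        rw [hm]
        have : DirichletDisc.zeroOrder χ (1 / 2) = 0 := by
          by_contra hne
          exact hzero ((DirichletDisc.zeroOrder_pos_iff χ hχ _).1 (Nat.pos_of_ne_zero hne))
        rw [this, Nat.cast_zero]
      obtain ⟨B, hB⟩ := exists_norm_halfLineSum_add_le_of_GRH hprim hq hzero hGRH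
      refine ⟨deriv χ.LFunction (1 / 2) / χ.LFunction (1 / 2), B, fun x hx ↦ ?_⟩
      rw [hm0, zero_mul, add_zero]
      exact hB x hx
  rw [← tendsto_sub_nhds_zero_iff]
  have hlim : Tendsto (fun x : ℝ ↦ ‖c₀‖ * (Real.log x)⁻¹ + B * ((Real.log x)⁻¹ * (Real.log x)⁻¹)) atTop (𝓝 0) := by
    have h0 := tendsto_inv_atTop_zero.comp Real.tendsto_log_atTop
    have h := (h0.const_mul ‖c₀‖).add ((h0.mul h0).const_mul B)
    simpa using h
  refine squeeze_zero_norm' ?_ hlim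
  filter_upwards [eventually_gt_atTop (1 : ℝ)] with x hx
  have hlx : 0 < Real.log x := Real.log_pos hx
  have hlx' : (Real.log x : ℂ) ≠ 0 := by exact_mod_cast hlx.ne'
  rw [rieszMean_eq_halfLineSum_div χ hx]
  have hkey : 1 / (Real.log x : ℂ) * (halfLineSum χ x / (Real.log x : ℂ)) - -(m / 2) =
      (halfLineSum χ x + (Real.log x : ℂ) * c₀ + m * (((Real.log x) ^ 2 / 2 : ℝ) : ℂ)
        - (Real.log x : ℂ) * c₀) / ((Real.log x : ℂ) * (Real.log x : ℂ)) := by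
    push_cast
    field_simp
    ring
  rw [hkey, norm_div, norm_mul, Complex.norm_real, Real.norm_of_nonneg hlx.le]
  have hnum : ‖halfLineSum χ x + (Real.log x : ℂ) * c₀ + m * (((Real.log x) ^ 2 / 2 : ℝ) : ℂ)
      - (Real.log x : ℂ) * c₀‖ ≤ B + Real.log x * ‖c₀‖ := by
    refine (norm_sub_le _ _).trans ?_
    rw [norm_mul, Complex.norm_real, Real.norm_of_nonneg hlx.le]
    linarith [hB x hx]
  rw [div_le_iff₀ (by positivity)]
  calc ‖halfLineSum χ x + (Real.log x : ℂ) * c₀ + m * (((Real.log x) ^ 2 / 2 : ℝ) : ℂ) - (Real.log x : ℂ) * c₀‖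
      ≤ B + Real.log x * ‖c₀‖ := hnum
    _ = (‖c₀‖ * (Real.log x)⁻¹ + B * ((Real.log x)⁻¹ * (Real.log x)⁻¹)) * (Real.log x * Real.log x) := by
        field_simp
        ring

end OrderM

end HalfLineRiesz

end Literature.NumberTheory.LFunctions

end
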